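import Literature.MathematicalPhysics.QuantumLattice.ProjectedEntangledPairStatesProofs
import Literature.MathematicalPhysics.QuantumLattice.SpinSystemProofs
import Literature.MathematicalPhysics.QuantumLattice.SpinChainsAkltFrustrationFreeProofs
import Mathlib.LinearAlgebra.Basis.VectorSpace
import HarnessLib

/-!
# Injective PEPS are unique ground states of their parent Hamiltonians (Schuch–Cirac–Pérez-García, Thm. 5.7)

Sibling proof file of `Literature/MathematicalPhysics/QuantumLattice/ProjectedEntangledPairStates.lean`
(next to `ProjectedEntangledPairStatesProofs.lean`). Theorems only: no statement or definition of
that file is changed and no definition is introduced. It discharges the named fact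

* `Literature.MathematicalPhysics.QuantumLattice.pepsParent_groundSpace_of_injective` — *for a
  single-site injective PEPS tensor `A` (`IsInjectivePEPS 1 1 A`) and `2 ≤ L`, the parent
  Hamiltonian `H = Σ_{x ∈ (ℤ/L)²} h_x`, `h_x = (1 - Π_{𝒮_{2×2}}) ⊗ 𝟙` on the `2 × 2` block anchored
  at `x`, has zero-energy space `ker H = ℂ · pepsTorus L A`*

as `pepsParent_groundSpace_of_injective_holds`.

## Source and its architecture

N. Schuch, I. Cirac, D. Pérez-García, *PEPS as ground states: degeneracy and topology*, Ann. Phys.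
**325** (2010) 2153–2192, arXiv:1001.3807 (held: `paper:arxiv-1001.3807`), §5.2: **Thm. 5.4**
(intersection property: growing an injective region keeps "the local space = block states with
arbitrary boundary tensor"), **Thm. 5.5** (closure property: intersecting the four open `L × L`
regions leaves only the `(g,h)`-closed PEPS, `gh = hg`), **Thm. 5.7** (parent Hamiltonian: "We
divide the Hamiltonian in four blocks with open boundary conditions … by virtue of the
intersection property the ground state subspace is given by one of the sets in (29), and thus
Theorem 5.5 yields the desired result"), **Thm. 5.9** (for the trivial group the single closure
`|ψ_A⟩` spans), all stated after Thm. 3.5 to "hold equally for injective PEPS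
[Pérez-García–Verstraete–Wolf–Cirac 2008]" (there: QIC **8** (2008) 650, §5 Thm. 3). The proofs
of Thms. 5.4/5.5 consist in "applying the left inverse of `𝒫(A)`" (Def. 3.1) to the physical legs
and comparing the resulting virtual tensors.

We formalize exactly this mechanism, organised at the **virtual level** of the whole torus, which
turns the intersection property into set algebra:

1. *Left inverse* (Def. 3.1). `exists_leg_leftInverse`: from `IsInjectivePEPS 1 1 A`, a tensor `t`
   with `Σ_s t(g,s) A^s_{g'} = δ_{g,g'}` (legs `g : Fin 2 → Fin 2 → Fin D`, axis × side). For a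
   region `R`, `𝒫^{⊗R} Φ (σ) = Σ_G (Π_x A^{σ_x}_{G_x}) Φ(G)` and `T^{⊗R} ψ (G) = Σ_σ (Π_x t(G_x,σ_x)) ψ(σ)`
   satisfy `T^{⊗R} 𝒫^{⊗R} = id` (`virtual_leftInverse`, Lemma 3.2) and `𝒫^{⊗R} T^{⊗R} = ⊗_x π`,
   `π = 𝒫(A) T` (`virtual_rightComp_apply`).
2. *Network states as virtual tensors.* `pepsTorus L A = 𝒫^{⊗Λ}(δ_all)` (`pepsTorus_eq_sum_legs`)
   and `pepsRect 2 2 A X = 𝒫^{⊗4}(δ_inner · X(outer legs))` (`pepsRect_two_two_eq_sum_legs`),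
   where a leg configuration *matches* the bond `(z, i)` if the outgoing leg of `z` along the axis
   `i` equals the incoming leg of `z + e_i`.
3. *The spaces `V_S`* (`S` a set of bonds): virtual tensors supported on the `S`-matched
   configurations and invariant under matched changes of the legs of `S` ("`δ` on `S` times an
   arbitrary function of the other legs" — the sets `{ζ(X)}` of §5.2). **Intersection property**
   (Thm. 5.4): `V_S ∩ V_{S'} ⊆ V_{S ∪ S'}` (`bondSpace_inter`, `bondSpace_biUnion`). **Closure**
   (Thm. 5.5, trivial group): `V_{all bonds} = ℂ δ_all` (`bondSpace_univ`).
4. *Zero-energy vectors.* `H ψ = 0` ⇒ each `h_x ψ = 0` (positivity) ⇒ every slice of `ψ` along the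
   block at `x` is a block state `ψ_X` (`exists_boundary_of_pepsParentHamiltonian_mulVec_eq_zero`;
   `ker (1 - Π_𝒮) = 𝒮 = range Γ`), ⇒ `T^{⊗Λ} ψ ∈ V_{S_x}` for the four inner bonds `S_x` of that
   block (`virtualT_mem_bondSpace`, the "apply the left inverse" step) ⇒ `T^{⊗Λ} ψ = c δ_all`, and
   `ψ = 𝒫^{⊗Λ} T^{⊗Λ} ψ` because `π` fixes `ψ` sitewise (`sum_pi_update_eq_self_of_slices`,
   `sum_prod_mul_eq_self_of_forall_update`), so `ψ = c 𝒫^{⊗Λ} δ_all = c ψ_A`.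
5. *Frustration-freeness* (the easy inclusions): `δ_all ∈ V_{S_x}`, and `𝒫^{⊗Λ}(V_{S_x})` has
   block-state slices along the block at `x` (`exists_pepsRect_slice_virtualP`), so `h_x ψ_A = 0`
   (`localOp_torusBlock_mulVec_eq_zero`) and `H ψ_A = 0`.

The hypothesis `2 ≤ L` enters through the injectivity of the anchor map `p ↦ x + p` of a `2 × 2`
block (`torusBlockSite_injective`), which identifies inner and outer legs of the block
(`legBond_torusBlockSite_mem_iff`); `L = 2` is allowed (the four open regions of Thm. 5.7 are then
single blocks). Degenerate `q = 0`: the Hilbert space is `0` and both sides hold.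

Reused from the tree: `localOp_mulVec_apply` / `localOp_mulVec_extend_val` and the gluing lemmas
(`SpinSystemProofs`), `projMatrix_mulVec`, `posSemidef_localOp`, `pepsLocalTerm_posSemidef`,
`pepsRect_one_one_apply`, `sum_fin_one_fun`, `prod_ite_apply_eq` (PEPS files),
`mulVec_eq_zero_of_sum_posSemidef` (kernel of a sum of positive matrices, from
`SpinChainsAkltFrustrationFreeProofs`), Mathlib's `LinearMap.exists_leftInverse_of_injective`,
`Submodule.starProjection_apply_eq_zero_iff`, `Submodule.orthogonal_orthogonal`.

## References

* N. Schuch, I. Cirac, D. Pérez-García, *PEPS as ground states: degeneracy and topology*,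
  Ann. Phys. **325** (2010) 2153–2192, doi:10.1016/j.aop.2010.05.008, arXiv:1001.3807: Def. 2.2,
  Def. 2.3, Def. 3.1, Lemma 3.2, Thm. 3.5, §5.2 Thm. 5.4, Thm. 5.5, Thm. 5.7, Thm. 5.9.
  [SchuchCiracPerezGarcia2010]
* D. Pérez-García, F. Verstraete, M. M. Wolf, J. I. Cirac, *PEPS as unique ground states of local
  Hamiltonians*, Quantum Inf. Comput. **8** (2008) 650–663, arXiv:0707.2260, §3–§5 (Thm. 3).
  [PerezGarciaVerstraeteWolfCirac2008PEPS]
-/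

noncomputable section

open Matrix Complex Finset
open scoped ComplexOrder

namespace Literature.MathematicalPhysics.QuantumLattice

open Literature.Probability.LatticeModels

section QLattice

variable {q D : ℕ}

/-! ### Reindexing sums along an injection with prescribed image -/

/-- Summing `F ∘ Ψ` over the domain of an injection `Ψ` is summing `F` over its image, written as
an indicator sum over the codomain. [folklore] -/
theorem sum_comp_eq_sum_ite_of_injective {α β M : Type*} [Fintype α] [Fintype β] [DecidableEq β]
    [AddCommMonoid M] (Ψ : α → β) (hΨ : Function.Injective Ψ) (p : β → Prop) [DecidablePred p]
    (hp : ∀ b, p b ↔ ∃ a, Ψ a = b) (F : β → M) :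
    ∑ a, F (Ψ a) = ∑ b, if p b then F b else 0 := by
  rw [← Finset.sum_filter, ← Finset.sum_image (f := F) fun a _ b _ h => hΨ h]
  refine Finset.sum_congr ?_ fun _ _ => rfl
  ext b
  simp only [Finset.mem_image, Finset.mem_univ, true_and, Finset.mem_filter, hp]

/-! ### The virtual level: `𝒫^{⊗R}`, `T^{⊗R}` and `T ∘ 𝒫 = id` -/

/-- **`T^{⊗R} ∘ 𝒫^{⊗R} = id` on the virtual level.** If `t` is a left inverse of the single-site
map `𝒫(A)` in coordinates (`Σ_s t(g,s) A^s_{g'} = δ_{g,g'}`), then applying `𝒫(A)` at every site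
of a finite region `R` to a virtual tensor `Φ` and then `t` at every site gives back `Φ`
(Schuch–Cirac–Pérez-García (2010), Def. 3.1 / Lemma 3.2: injectivity is stable under taking
tensor products). [cite: SchuchCiracPerezGarcia2010, Def. 3.1 and Lemma 3.2] -/
theorem virtual_leftInverse {R : Type*} [Fintype R] [DecidableEq R] (A : PEPSTensor q D)
    (t : (Fin 2 → Fin 2 → Fin D) → Fin q → ℂ)
    (ht : ∀ g g' : Fin 2 → Fin 2 → Fin D,
      ∑ s, t g s * A s (g' 0 0) (g' 1 0) (g' 0 1) (g' 1 1) = if g = g' then 1 else 0)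
    (Φ : (R → Fin 2 → Fin 2 → Fin D) → ℂ) (G : R → Fin 2 → Fin 2 → Fin D) :
    ∑ σ : R → Fin q, (∏ x, t (G x) (σ x)) *
      ∑ G' : R → Fin 2 → Fin 2 → Fin D,
        (∏ x, A (σ x) (G' x 0 0) (G' x 1 0) (G' x 0 1) (G' x 1 1)) * Φ G' = Φ G := by
  calc ∑ σ : R → Fin q, (∏ x, t (G x) (σ x)) *
        ∑ G' : R → Fin 2 → Fin 2 → Fin D,
          (∏ x, A (σ x) (G' x 0 0) (G' x 1 0) (G' x 0 1) (G' x 1 1)) * Φ G'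
      = ∑ G' : R → Fin 2 → Fin 2 → Fin D, (∑ σ : R → Fin q,
          ∏ x, t (G x) (σ x) * A (σ x) (G' x 0 0) (G' x 1 0) (G' x 0 1) (G' x 1 1)) * Φ G' := by
        simp only [Finset.mul_sum, Finset.sum_mul, Finset.prod_mul_distrib, mul_assoc]
        exact Finset.sum_comm
    _ = ∑ G' : R → Fin 2 → Fin 2 → Fin D, (if G = G' then 1 else 0) * Φ G' := by
        refine Finset.sum_congr rfl fun G' _ => ?_
        rw [← Fintype.prod_sum fun x s => t (G x) s * A s (G' x 0 0) (G' x 1 0) (G' x 0 1) (G' x 1 1)]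
        simp only [ht]
        rw [prod_ite_apply_eq]
    _ = Φ G := by simp [Finset.sum_ite_eq]

/-- **`𝒫^{⊗R} ∘ T^{⊗R}` is the tensor power of the single-site operator `π = 𝒫(A) T`**:
`(𝒫 T ψ)(σ) = Σ_τ (Π_x π(σ_x, τ_x)) ψ(τ)` with `π(s, s') = Σ_g A^s_g t(g, s')`. [folklore] -/
theorem virtual_rightComp_apply {R : Type*} [Fintype R] [DecidableEq R] (A : PEPSTensor q D)
    (t : (Fin 2 → Fin 2 → Fin D) → Fin q → ℂ) (ψ : (R → Fin q) → ℂ) (σ : R → Fin q) :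
    ∑ G : R → Fin 2 → Fin 2 → Fin D, (∏ x, A (σ x) (G x 0 0) (G x 1 0) (G x 0 1) (G x 1 1)) *
        ∑ τ : R → Fin q, (∏ x, t (G x) (τ x)) * ψ τ =
      ∑ τ : R → Fin q, (∏ x, ∑ g : Fin 2 → Fin 2 → Fin D,
        A (σ x) (g 0 0) (g 1 0) (g 0 1) (g 1 1) * t g (τ x)) * ψ τ := by
  calc ∑ G : R → Fin 2 → Fin 2 → Fin D, (∏ x, A (σ x) (G x 0 0) (G x 1 0) (G x 0 1) (G x 1 1)) *
        ∑ τ : R → Fin q, (∏ x, t (G x) (τ x)) * ψ τ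
      = ∑ τ : R → Fin q, (∑ G : R → Fin 2 → Fin 2 → Fin D,
          ∏ x, A (σ x) (G x 0 0) (G x 1 0) (G x 0 1) (G x 1 1) * t (G x) (τ x)) * ψ τ := by
        simp only [Finset.mul_sum, Finset.sum_mul, Finset.prod_mul_distrib, mul_assoc]
        exact Finset.sum_comm
    _ = _ := by
        refine Finset.sum_congr rfl fun τ _ => ?_
        rw [← Fintype.prod_sum fun x g => A (σ x) (g 0 0) (g 1 0) (g 0 1) (g 1 1) * t g (τ x)]

/-- **Tensor powers of a single-site identity.** If a single-site matrix `π` fixes `ψ` when applied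
at any one site (`Σ_s π(σ_y, s) ψ(σ[y ↦ s]) = ψ(σ)`), then its tensor power `⊗_x π` fixes `ψ`:
`Σ_τ (Π_x π(σ_x, τ_x)) ψ(τ) = ψ(σ)` (apply the sites one at a time). [folklore] -/
theorem sum_prod_mul_eq_self_of_forall_update {R : Type*} [Fintype R] [DecidableEq R]
    (π : Fin q → Fin q → ℂ) (ψ : (R → Fin q) → ℂ)
    (hψ : ∀ (y : R) (σ : R → Fin q), ∑ s, π (σ y) s * ψ (Function.update σ y s) = ψ σ)
    (σ : R → Fin q) : ∑ τ : R → Fin q, (∏ x, π (σ x) (τ x)) * ψ τ = ψ σ := by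
  -- `⊗_{x ∈ S} π ⊗ 𝟙` fixes `ψ`, by induction on `S`
  suffices h : ∀ (S : Finset R) (σ : R → Fin q), ∑ τ : R → Fin q,
      (∏ x, if x ∈ S then π (σ x) (τ x) else if τ x = σ x then 1 else 0) * ψ τ = ψ σ by
    simpa using h Finset.univ σ
  intro S
  induction S using Finset.induction_on with
  | empty =>
    intro σ
    simp only [Finset.notMem_empty, if_false, prod_ite_apply_eq]
    simp [Finset.sum_ite_eq']
  | insert y S hy ih =>
    intro σ
    -- the factors off `y` do not see the update at `y`
    have hoff : ∀ (s : Fin q) (τ : R → Fin q),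
        (∏ x ∈ Finset.univ.erase y, if x ∈ S then π (Function.update σ y s x) (τ x)
          else if τ x = Function.update σ y s x then 1 else 0) =
        ∏ x ∈ Finset.univ.erase y,
          if x ∈ insert y S then π (σ x) (τ x) else if τ x = σ x then 1 else 0 := by
      intro s τ
      refine Finset.prod_congr rfl fun x hx => ?_
      have hxy : x ≠ y := Finset.ne_of_mem_erase hx
      rw [Function.update_of_ne hxy]
      simp only [Finset.mem_insert, hxy, false_or]
    -- expand the factor at `y`: `M_{S ∪ y}(σ, τ) = Σ_s π(σ_y, s) M_S(σ[y ↦ s], τ)`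
    have hexp : ∀ τ : R → Fin q,
        (∏ x, if x ∈ insert y S then π (σ x) (τ x) else if τ x = σ x then 1 else 0) =
          ∑ s, π (σ y) s * ∏ x, if x ∈ S then π (Function.update σ y s x) (τ x)
            else if τ x = Function.update σ y s x then 1 else 0 := by
      intro τ
      have h1 : ∀ s, (∏ x, if x ∈ S then π (Function.update σ y s x) (τ x)
            else if τ x = Function.update σ y s x then 1 else 0) =
          (if τ y = s then 1 else 0) * ∏ x ∈ Finset.univ.erase y,
            if x ∈ insert y S then π (σ x) (τ x) else if τ x = σ x then 1 else 0 := by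
        intro s
        rw [← Finset.mul_prod_erase _ _ (Finset.mem_univ y), hoff s τ]
        simp only [hy, if_false, Function.update_self]
      rw [← Finset.mul_prod_erase _ _ (Finset.mem_univ y)]
      simp only [h1, ← mul_assoc, ← Finset.sum_mul, Finset.mem_insert, true_or, if_true]
      congr 1
      simp only [mul_ite, mul_one, mul_zero]
      rw [Finset.sum_ite_eq, if_pos (Finset.mem_univ _)]
    simp only [hexp, Finset.sum_mul, mul_assoc]
    rw [Finset.sum_comm]
    simp only [← Finset.mul_sum, ih]
    exact hψ y σ

/-! ### The single-site left inverse (Schuch–Cirac–Pérez-García Def. 3.1) -/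

/-- The `1 × 1` block map in leg coordinates `g : Fin 2 → Fin 2 → Fin D` (axis, side:
`g 0 0 = l`, `g 1 0 = u`, `g 0 1 = r`, `g 1 1 = d`): for the boundary tensor
`X(l,u,r,d) = Y(![![l 0, r 0], ![u 0, d 0]])` one has `pepsRect 1 1 A X σ = Σ_g A^{σ(0,0)}_g Y(g)`,
i.e. `𝒫(A)` of Schuch–Cirac–Pérez-García (2010), Def. 2.3. [cite: SchuchCiracPerezGarcia2010, Def. 2.3] -/
theorem pepsRect_one_one_eq_sum_legs (A : PEPSTensor q D) (Y : (Fin 2 → Fin 2 → Fin D) → ℂ)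
    (σ : TensorIndex (Fin 1 × Fin 1) q) :
    pepsRect 1 1 A (fun l u r d => Y ![![l 0, r 0], ![u 0, d 0]]) σ =
      ∑ g : Fin 2 → Fin 2 → Fin D, A (σ (0, 0)) (g 0 0) (g 1 0) (g 0 1) (g 1 1) * Y g := by
  rw [pepsRect_one_one_apply]
  simp only [sum_fin_one_fun]
  let e : (Fin 2 → Fin 2 → Fin D) ≃ (Fin D × Fin D) × (Fin D × Fin D) :=
    (finTwoArrowEquiv (Fin 2 → Fin D)).trans
      ((finTwoArrowEquiv (Fin D)).prodCongr (finTwoArrowEquiv (Fin D)))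
  rw [← e.symm.sum_comp]
  simp only [Fintype.sum_prod_type]
  rfl

/-- A leg configuration is the `2 × 2` array of its entries. [folklore] -/
theorem vec2_vec2_eta (g : Fin 2 → Fin 2 → Fin D) :
    (![![g 0 0, g 0 1], ![g 1 0, g 1 1]] : Fin 2 → Fin 2 → Fin D) = g := by
  funext i j
  fin_cases i <;> fin_cases j <;> rfl

/-- **Single-site injectivity in leg coordinates**: if the `1 × 1` block map is injective
(`IsInjectivePEPS 1 1 A`, Schuch–Cirac–Pérez-García (2010) Def. 3.1), then so is
`Y ↦ (s ↦ Σ_g A^s_g Y(g))` on functions of the four legs. [cite: SchuchCiracPerezGarcia2010, Def. 3.1] -/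
theorem legMap_injective (A : PEPSTensor q D) (hA : IsInjectivePEPS 1 1 A) :
    Function.Injective (fun (Y : (Fin 2 → Fin 2 → Fin D) → ℂ) (s : Fin q) =>
      ∑ g : Fin 2 → Fin 2 → Fin D, A s (g 0 0) (g 1 0) (g 0 1) (g 1 1) * Y g) := by
  intro Y Y' h
  have hX : pepsRect 1 1 A (fun l u r d => Y ![![l 0, r 0], ![u 0, d 0]]) =
      pepsRect 1 1 A (fun l u r d => Y' ![![l 0, r 0], ![u 0, d 0]]) := by
    funext σ
    rw [pepsRect_one_one_eq_sum_legs, pepsRect_one_one_eq_sum_legs]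
    exact congrFun h (σ (0, 0))
  have hXX := hA hX
  funext g
  have h1 := congrFun (congrFun (congrFun (congrFun hXX (fun _ => g 0 0)) (fun _ => g 1 0))
    (fun _ => g 0 1)) (fun _ => g 1 1)
  simp only [vec2_vec2_eta] at h1
  exact h1

/-- **The single-site left inverse.** For an injective tensor (Schuch–Cirac–Pérez-García (2010)
Def. 3.1: `𝒫(A)` has a left inverse) there is `t` with `Σ_s t(g, s) A^s_{g'} = δ_{g,g'}`: a left
inverse of the injective linear map `Y ↦ Σ_g A^s_g Y(g)` (`LinearMap.exists_leftInverse_of_injective`)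
read in coordinates. [cite: SchuchCiracPerezGarcia2010, Def. 3.1] -/
theorem exists_leg_leftInverse (A : PEPSTensor q D) (hA : IsInjectivePEPS 1 1 A) :
    ∃ t : (Fin 2 → Fin 2 → Fin D) → Fin q → ℂ, ∀ g g' : Fin 2 → Fin 2 → Fin D,
      ∑ s, t g s * A s (g' 0 0) (g' 1 0) (g' 0 1) (g' 1 1) = if g = g' then 1 else 0 := by
  let M : ((Fin 2 → Fin 2 → Fin D) → ℂ) →ₗ[ℂ] (Fin q → ℂ) :=
    { toFun := fun Y s => ∑ g, A s (g 0 0) (g 1 0) (g 0 1) (g 1 1) * Y g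
      map_add' := fun Y Y' => by
        funext s
        simp only [Pi.add_apply, mul_add, Finset.sum_add_distrib]
      map_smul' := fun c Y => by
        funext s
        simp only [Pi.smul_apply, smul_eq_mul, RingHom.id_apply, Finset.mul_sum, mul_left_comm] }
  have hker : LinearMap.ker M = ⊥ := LinearMap.ker_eq_bot.2 (legMap_injective A hA)
  obtain ⟨T, hT⟩ := M.exists_leftInverse_of_injective hker
  refine ⟨fun g s => T (Pi.single s 1) g, fun g g' => ?_⟩
  have hM : M (Pi.single g' 1) =
      ∑ s, A s (g' 0 0) (g' 1 0) (g' 0 1) (g' 1 1) • (Pi.single s 1 : Fin q → ℂ) := by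
    funext s
    simp only [M, LinearMap.coe_mk, AddHom.coe_mk, Pi.single_apply, mul_ite, mul_one, mul_zero,
      Finset.sum_ite_eq', Finset.mem_univ, if_true, Finset.sum_apply, Pi.smul_apply, smul_eq_mul]
    rw [Finset.sum_eq_single s]
    · simp
    · intro s' _ hs'
      simp [Ne.symm hs']
    · simp
  have h := congrFun (LinearMap.congr_fun hT (Pi.single g' 1)) g
  rw [LinearMap.comp_apply, hM, map_sum, LinearMap.id_apply] at h
  simp only [map_smul, Finset.sum_apply, Pi.smul_apply, smul_eq_mul] at h
  rw [Pi.single_apply] at h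
  rw [← h]
  exact Finset.sum_congr rfl fun s _ => mul_comm _ _

/-! ### Network contractions as indicator sums over leg configurations -/

/-- **The `2 × 2` block contraction in leg coordinates.** Summing a function of the sixteen legs
of a `2 × 2` block against the block weight over the bond variables `η, ν` of `pepsRect 2 2` is
the sum over all leg configurations `G : Fin 2 × Fin 2 → (legs)` whose four inner bonds match
(right leg of column `0` = left leg of column `1`, down leg of row `0` = up leg of row `1`).
Pérez-García–Verstraete–Wolf–Cirac (2008) §4 (`Γ_R`). [cite: PerezGarciaVerstraeteWolfCirac2008PEPS, §4] -/
theorem sum_pepsRectWeight_two_two (A : PEPSTensor q D) (ρ : TensorIndex (Fin 2 × Fin 2) q)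
    (Y : (Fin 2 × Fin 2 → Fin 2 → Fin 2 → Fin D) → ℂ) :
    ∑ η : Fin 3 × Fin 2 → Fin D, ∑ ν : Fin 2 × Fin 3 → Fin D, pepsRectWeight 2 2 A ρ η ν *
        Y (fun p => ![![η (p.1.castSucc, p.2), η (p.1.succ, p.2)],
          ![ν (p.1, p.2.castSucc), ν (p.1, p.2.succ)]]) =
      ∑ G : Fin 2 × Fin 2 → Fin 2 → Fin 2 → Fin D,
        if (∀ b : Fin 2, G (0, b) 0 1 = G (1, b) 0 0) ∧ (∀ a : Fin 2, G (a, 0) 1 1 = G (a, 1) 1 0)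
        then (∏ p, A (ρ p) (G p 0 0) (G p 1 0) (G p 0 1) (G p 1 1)) * Y G else 0 := by
  -- the parametrisation of inner-matched leg configurations by bond variables
  let Ψ : (Fin 3 × Fin 2 → Fin D) × (Fin 2 × Fin 3 → Fin D) → Fin 2 × Fin 2 → Fin 2 → Fin 2 → Fin D :=
    fun ην p => ![![ην.1 (p.1.castSucc, p.2), ην.1 (p.1.succ, p.2)],
      ![ην.2 (p.1, p.2.castSucc), ην.2 (p.1, p.2.succ)]]
  have hΨ : Function.Injective Ψ := by
    rintro ⟨η, ν⟩ ⟨η', ν'⟩ h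
    simp only [Prod.mk.injEq]
    constructor
    · funext ⟨a', b⟩
      refine Fin.cases ?_ (fun a => ?_) a'
      · exact congrFun (congrFun (congrFun h ((0 : Fin 2), b)) 0) 0
      · exact congrFun (congrFun (congrFun h (a, b)) 0) 1
    · funext ⟨a, b'⟩
      refine Fin.cases ?_ (fun b => ?_) b'
      · exact congrFun (congrFun (congrFun h (a, (0 : Fin 2))) 1) 0
      · exact congrFun (congrFun (congrFun h (a, b)) 1) 1
  have himage : ∀ G : Fin 2 × Fin 2 → Fin 2 → Fin 2 → Fin D,
      ((∀ b : Fin 2, G (0, b) 0 1 = G (1, b) 0 0) ∧ (∀ a : Fin 2, G (a, 0) 1 1 = G (a, 1) 1 0)) ↔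
        ∃ ην, Ψ ην = G := by
    intro G
    constructor
    · rintro ⟨hh, hv⟩
      refine ⟨(fun ab => ![G (0, ab.2) 0 0, G (0, ab.2) 0 1, G (1, ab.2) 0 1] ab.1,
        fun ab => ![G (ab.1, 0) 1 0, G (ab.1, 0) 1 1, G (ab.1, 1) 1 1] ab.2), ?_⟩
      funext ⟨a, b⟩ i s
      fin_cases a <;> fin_cases b <;> fin_cases i <;> fin_cases s <;> simp [Ψ, hh, hv]
    · rintro ⟨⟨η, ν⟩, rfl⟩
      exact ⟨fun b => rfl, fun a => rfl⟩
  rw [← Fintype.sum_prod_type']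
  exact sum_comp_eq_sum_ite_of_injective Ψ hΨ _ himage
    (fun G => (∏ p, A (ρ p) (G p 0 0) (G p 1 0) (G p 0 1) (G p 1 1)) * Y G)

/-- **The `2 × 2` block map in leg coordinates**: `pepsRect 2 2 A X` is `𝒫^{⊗4}` applied to the
virtual tensor "`δ` on the four inner bonds times `X` of the eight outer legs".
Pérez-García–Verstraete–Wolf–Cirac (2008) §4; Schuch–Cirac–Pérez-García (2010) §5.2.
[cite: PerezGarciaVerstraeteWolfCirac2008PEPS, §4] -/
theorem pepsRect_two_two_eq_sum_legs (A : PEPSTensor q D) (X : PEPSBoundary D 2 2)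
    (ρ : TensorIndex (Fin 2 × Fin 2) q) :
    pepsRect 2 2 A X ρ = ∑ G : Fin 2 × Fin 2 → Fin 2 → Fin 2 → Fin D,
        if (∀ b : Fin 2, G (0, b) 0 1 = G (1, b) 0 0) ∧ (∀ a : Fin 2, G (a, 0) 1 1 = G (a, 1) 1 0)
        then (∏ p, A (ρ p) (G p 0 0) (G p 1 0) (G p 0 1) (G p 1 1)) *
          X (fun b => G (0, b) 0 0) (fun a => G (a, 0) 1 0) (fun b => G (1, b) 0 1)
            (fun a => G (a, 1) 1 1) else 0 := by
  rw [← sum_pepsRectWeight_two_two]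
  rfl

/-- **The torus PEPS in leg coordinates**: `pepsTorus L A = 𝒫^{⊗Λ}(δ_all)`, the sum over all leg
configurations on the torus in which every bond matches (right leg of `y` = left leg of
`y + e₀`, down leg of `y` = up leg of `y + e₁`). Schuch–Cirac–Pérez-García (2010) Def. 2.2.
[cite: SchuchCiracPerezGarcia2010, Def. 2.2] -/
theorem pepsTorus_eq_sum_legs (L : ℕ) [NeZero L] (A : PEPSTensor q D)
    (σ : TensorIndex (TorusSite 2 L) q) :
    pepsTorus L A σ = ∑ G : TorusSite 2 L → Fin 2 → Fin 2 → Fin D,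
      if (∀ (y : TorusSite 2 L) (i : Fin 2), G y i 1 = G (y + torusUnit L i) i 0) then
        ∏ y, A (σ y) (G y 0 0) (G y 1 0) (G y 0 1) (G y 1 1) else 0 := by
  let Ψ : (TorusSite 2 L → Fin D) × (TorusSite 2 L → Fin D) →
      TorusSite 2 L → Fin 2 → Fin 2 → Fin D :=
    fun ην y => ![![ην.1 (y - torusUnit L 0), ην.1 y], ![ην.2 (y - torusUnit L 1), ην.2 y]]
  have hΨ : Function.Injective Ψ := by
    rintro ⟨η, ν⟩ ⟨η', ν'⟩ h
    simp only [Prod.mk.injEq]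
    exact ⟨funext fun y => congrFun (congrFun (congrFun h y) 0) 1,
      funext fun y => congrFun (congrFun (congrFun h y) 1) 1⟩
  have himage : ∀ G : TorusSite 2 L → Fin 2 → Fin 2 → Fin D,
      (∀ (y : TorusSite 2 L) (i : Fin 2), G y i 1 = G (y + torusUnit L i) i 0) ↔ ∃ ην, Ψ ην = G := by
    intro G
    constructor
    · intro hG
      refine ⟨(fun y => G y 0 1, fun y => G y 1 1), ?_⟩
      funext y i s
      have h0 := hG (y - torusUnit L 0) 0
      have h1 := hG (y - torusUnit L 1) 1
      rw [sub_add_cancel] at h0 h1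
      fin_cases i <;> fin_cases s <;> simp [Ψ, h0, h1]
    · rintro ⟨⟨η, ν⟩, rfl⟩ y i
      fin_cases i <;> simp [Ψ]
  simp only [pepsTorus]
  rw [← Fintype.sum_prod_type']
  exact sum_comp_eq_sum_ite_of_injective Ψ hΨ _ himage
    (fun G => ∏ y, A (σ y) (G y 0 0) (G y 1 0) (G y 0 1) (G y 1 1))

/-! ### Bonds of the torus and the spaces `V_S` (intersection and closure at the virtual level)

A leg of the torus is `(y, i, s)` (site, axis, side: `s = 0` incoming = left/up, `s = 1` outgoing
= right/down); a bond is `(z, i)` with legs `(z, i, 1)` and `(z + e_i, i, 0)`, so the bond of the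
leg `(y, i, s)` is `(![y - e_i, y] s, i)`. A leg configuration `G` *matches* the bond `(z, i)` if
`G z i 1 = G (z + e_i) i 0`. For a set `S` of bonds, `V_S` is the space of virtual tensors `Φ`
supported on the `S`-matched configurations and invariant under changing the legs of bonds in `S`
(keeping them matched) — the virtual-level form of the sets `{ζ(X) | X}` of
Schuch–Cirac–Pérez-García (2010) §5.2 (tensor `δ` on the bonds of `S`, arbitrary `X` on the other
legs). We never name `V_S`; its two defining clauses are spelled out. -/

/-- **Intersection property at the virtual level** (the mechanism of Schuch–Cirac–Pérez-García
(2010) Thm. 5.4): `V_S ∩ V_{S'} ⊆ V_{S ∪ S'}` — a virtual tensor that is "`δ` on the bonds of `S`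
times a function of the remaining legs" and also "`δ` on `S'` times a function of the rest" is
"`δ` on `S ∪ S'` times a function of the rest". [cite: SchuchCiracPerezGarcia2010, Thm. 5.4] -/
theorem bondSpace_inter {L : ℕ} {S S' : Finset (TorusSite 2 L × Fin 2)}
    {Φ : (TorusSite 2 L → Fin 2 → Fin 2 → Fin D) → ℂ}
    (h1 : ∀ G, (∃ b ∈ S, G b.1 b.2 1 ≠ G (b.1 + torusUnit L b.2) b.2 0) → Φ G = 0)
    (h2 : ∀ G G' : TorusSite 2 L → Fin 2 → Fin 2 → Fin D,
      (∀ b ∈ S, G b.1 b.2 1 = G (b.1 + torusUnit L b.2) b.2 0) →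
      (∀ b ∈ S, G' b.1 b.2 1 = G' (b.1 + torusUnit L b.2) b.2 0) →
      (∀ y i s, (![y - torusUnit L i, y] s, i) ∉ S → G y i s = G' y i s) → Φ G = Φ G')
    (h1' : ∀ G, (∃ b ∈ S', G b.1 b.2 1 ≠ G (b.1 + torusUnit L b.2) b.2 0) → Φ G = 0)
    (h2' : ∀ G G' : TorusSite 2 L → Fin 2 → Fin 2 → Fin D,
      (∀ b ∈ S', G b.1 b.2 1 = G (b.1 + torusUnit L b.2) b.2 0) →
      (∀ b ∈ S', G' b.1 b.2 1 = G' (b.1 + torusUnit L b.2) b.2 0) →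
      (∀ y i s, (![y - torusUnit L i, y] s, i) ∉ S' → G y i s = G' y i s) → Φ G = Φ G') :
    (∀ G, (∃ b ∈ S ∪ S', G b.1 b.2 1 ≠ G (b.1 + torusUnit L b.2) b.2 0) → Φ G = 0) ∧
    (∀ G G' : TorusSite 2 L → Fin 2 → Fin 2 → Fin D,
      (∀ b ∈ S ∪ S', G b.1 b.2 1 = G (b.1 + torusUnit L b.2) b.2 0) →
      (∀ b ∈ S ∪ S', G' b.1 b.2 1 = G' (b.1 + torusUnit L b.2) b.2 0) →
      (∀ y i s, (![y - torusUnit L i, y] s, i) ∉ S ∪ S' → G y i s = G' y i s) → Φ G = Φ G') := by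
  classical
  refine ⟨fun G ⟨b, hb, hG⟩ => ?_, fun G G' hG hG' hGG' => ?_⟩
  · rcases Finset.mem_union.1 hb with hb | hb
    · exact h1 G ⟨b, hb, hG⟩
    · exact h1' G ⟨b, hb, hG⟩
  · -- the mixed configuration: legs of bonds in `S` from `G'`, all other legs from `G`
    let G'' : TorusSite 2 L → Fin 2 → Fin 2 → Fin D :=
      fun y i s => if (![y - torusUnit L i, y] s, i) ∈ S then G' y i s else G y i s
    have hleg1 : ∀ (z : TorusSite 2 L) (i : Fin 2), (![z - torusUnit L i, z] 1, i) = (z, i) :=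
      fun z i => rfl
    have hleg0 : ∀ (z : TorusSite 2 L) (i : Fin 2),
        (![z + torusUnit L i - torusUnit L i, z + torusUnit L i] 0, i) = (z, i) := fun z i => by
      simp
    -- `G''` matches every bond of `S` (both legs come from `G'`)
    have hA : ∀ b ∈ S, G'' b.1 b.2 1 = G'' (b.1 + torusUnit L b.2) b.2 0 := by
      rintro ⟨z, i⟩ hb
      simp only [G'', hleg1, hleg0, hb, if_true]
      exact hG' (z, i) (Finset.mem_union_left _ hb)
    -- and every bond of `S'` (off `S` both legs come from `G`)
    have hB : ∀ b ∈ S', G'' b.1 b.2 1 = G'' (b.1 + torusUnit L b.2) b.2 0 := by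
      rintro ⟨z, i⟩ hb
      by_cases hbS : (z, i) ∈ S
      · exact hA (z, i) hbS
      · simp only [G'', hleg1, hleg0, hbS, if_false]
        exact hG (z, i) (Finset.mem_union_right _ hb)
    -- `G''` agrees with `G` off the legs of `S`, with `G'` off the legs of `S'`
    have hC : ∀ y i s, (![y - torusUnit L i, y] s, i) ∉ S → G y i s = G'' y i s := by
      intro y i s h
      simp only [G'', h, if_false]
    have hD : ∀ y i s, (![y - torusUnit L i, y] s, i) ∉ S' → G'' y i s = G' y i s := by
      intro y i s h
      by_cases hS : (![y - torusUnit L i, y] s, i) ∈ S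
      · simp only [G'', hS, if_true]
      · simp only [G'', hS, if_false]
        exact hGG' y i s (by simp [Finset.mem_union, hS, h])
    rw [h2 G G'' (fun b hb => hG b (Finset.mem_union_left _ hb)) hA hC, h2' G'' G' hB
      (fun b hb => hG' b (Finset.mem_union_right _ hb)) hD]

/-- **Closure at the virtual level** (the mechanism of Schuch–Cirac–Pérez-García (2010) Thm. 5.5
for the trivial group): `V_{all bonds}` is the line spanned by `δ_all` — a virtual tensor supported
on the fully matched configurations and invariant under all matched changes is a constant
multiple of the indicator of the fully matched configurations.
[cite: SchuchCiracPerezGarcia2010, Thm. 5.5] -/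
theorem bondSpace_univ {L : ℕ} [NeZero L] {Φ : (TorusSite 2 L → Fin 2 → Fin 2 → Fin D) → ℂ}
    (h1 : ∀ G, (∃ b ∈ (Finset.univ : Finset (TorusSite 2 L × Fin 2)),
      G b.1 b.2 1 ≠ G (b.1 + torusUnit L b.2) b.2 0) → Φ G = 0)
    (h2 : ∀ G G' : TorusSite 2 L → Fin 2 → Fin 2 → Fin D,
      (∀ b ∈ (Finset.univ : Finset (TorusSite 2 L × Fin 2)),
        G b.1 b.2 1 = G (b.1 + torusUnit L b.2) b.2 0) →
      (∀ b ∈ (Finset.univ : Finset (TorusSite 2 L × Fin 2)),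
        G' b.1 b.2 1 = G' (b.1 + torusUnit L b.2) b.2 0) →
      (∀ y i s, (![y - torusUnit L i, y] s, i) ∉ (Finset.univ : Finset (TorusSite 2 L × Fin 2)) →
        G y i s = G' y i s) → Φ G = Φ G') :
    ∃ c : ℂ, Φ = fun G => if (∀ (y : TorusSite 2 L) (i : Fin 2), G y i 1 = G (y + torusUnit L i) i 0)
      then c else 0 := by
  classical
  by_cases hex : ∃ G₀ : TorusSite 2 L → Fin 2 → Fin 2 → Fin D,
      ∀ (y : TorusSite 2 L) (i : Fin 2), G₀ y i 1 = G₀ (y + torusUnit L i) i 0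
  · obtain ⟨G₀, hG₀⟩ := hex
    refine ⟨Φ G₀, funext fun G => ?_⟩
    split_ifs with hG
    · exact h2 G G₀ (fun b _ => hG b.1 b.2) (fun b _ => hG₀ b.1 b.2)
        fun y i s h => absurd (Finset.mem_univ _) h
    · push Not at hG
      obtain ⟨y, i, hyi⟩ := hG
      exact h1 G ⟨(y, i), Finset.mem_univ _, hyi⟩
  · refine ⟨0, funext fun G => ?_⟩
    have hG : ¬ ∀ (y : TorusSite 2 L) (i : Fin 2), G y i 1 = G (y + torusUnit L i) i 0 :=
      fun h => hex ⟨G, h⟩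
    rw [if_neg hG]
    push Not at hG
    obtain ⟨y, i, hyi⟩ := hG
    exact h1 G ⟨(y, i), Finset.mem_univ _, hyi⟩

/-- `V_∅` is everything: the two clauses hold trivially for the empty set of bonds. [folklore] -/
theorem bondSpace_empty {L : ℕ} (Φ : (TorusSite 2 L → Fin 2 → Fin 2 → Fin D) → ℂ) :
    (∀ G, (∃ b ∈ (∅ : Finset (TorusSite 2 L × Fin 2)),
      G b.1 b.2 1 ≠ G (b.1 + torusUnit L b.2) b.2 0) → Φ G = 0) ∧
    (∀ G G' : TorusSite 2 L → Fin 2 → Fin 2 → Fin D,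
      (∀ b ∈ (∅ : Finset (TorusSite 2 L × Fin 2)), G b.1 b.2 1 = G (b.1 + torusUnit L b.2) b.2 0) →
      (∀ b ∈ (∅ : Finset (TorusSite 2 L × Fin 2)), G' b.1 b.2 1 = G' (b.1 + torusUnit L b.2) b.2 0) →
      (∀ y i s, (![y - torusUnit L i, y] s, i) ∉ (∅ : Finset (TorusSite 2 L × Fin 2)) →
        G y i s = G' y i s) → Φ G = Φ G') := by
  refine ⟨fun G ⟨b, hb, _⟩ => absurd hb (Finset.notMem_empty b), fun G G' _ _ h => ?_⟩
  rw [show G = G' from funext fun y => funext fun i => funext fun s =>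
    h y i s (Finset.notMem_empty _)]

/-! ### Geometry of the `2 × 2` block of the torus anchored at `x` (`2 ≤ L`) -/

/-- The anchor is the block site `(0, 0)`. [folklore] -/
theorem torusBlockSite_zero_zero (L n m : ℕ) (x : TorusSite 2 L) :
    torusBlockSite L (n + 1) (m + 1) x (0, 0) = x := by
  unfold torusBlockSite
  ext j
  fin_cases j <;> simp

/-- For `n, m ≤ L` the anchor map `p ↦ x + p` of an `n × m` block is injective. [folklore] -/
theorem torusBlockSite_injective (L n m : ℕ) (hn : n ≤ L) (hm : m ≤ L) (x : TorusSite 2 L) :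
    Function.Injective (torusBlockSite L n m x) := by
  rintro ⟨a, b⟩ ⟨a', b'⟩ h
  have h' : (![((a : ℕ) : ZMod L), ((b : ℕ) : ZMod L)] : TorusSite 2 L) =
      ![((a' : ℕ) : ZMod L), ((b' : ℕ) : ZMod L)] := add_left_cancel h
  have ha := congrArg ZMod.val (congrFun h' 0)
  have hb := congrArg ZMod.val (congrFun h' 1)
  simp only [Matrix.cons_val_zero, Matrix.cons_val_one, Matrix.cons_val_fin_one] at ha hb
  rw [ZMod.val_cast_of_lt (a.2.trans_le hn), ZMod.val_cast_of_lt (a'.2.trans_le hn)] at ha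
  rw [ZMod.val_cast_of_lt (b.2.trans_le hm), ZMod.val_cast_of_lt (b'.2.trans_le hm)] at hb
  exact Prod.ext (Fin.ext ha) (Fin.ext hb)

/-- For `n, m ≤ L` the anchor map is a bijection onto the block. [folklore] -/
theorem torusBlockElem_bijective (L n m : ℕ) [NeZero L] (hn : n ≤ L) (hm : m ≤ L)
    (x : TorusSite 2 L) : Function.Bijective (torusBlockElem L n m x) := by
  refine ⟨fun p p' h => torusBlockSite_injective L n m hn hm x (congrArg Subtype.val h), fun y => ?_⟩
  obtain ⟨y, hy⟩ := y
  obtain ⟨p, -, rfl⟩ := Finset.mem_image.1 hy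
  exact ⟨p, rfl⟩

/-- The inner bonds of the `2 × 2` block: stepping from the base site `x + (0, c)` (horizontal,
`i = 0`) resp. `x + (c, 0)` (vertical, `i = 1`) along `e_i` lands on `x + (1, c)` resp.
`x + (c, 1)`. [folklore] -/
theorem torusBlockSite_innerBase_add_unit (L : ℕ) (x : TorusSite 2 L) (i c : Fin 2) :
    torusBlockSite L 2 2 x (![((0 : Fin 2), c), (c, 0)] i) + torusUnit L i =
      torusBlockSite L 2 2 x (![((1 : Fin 2), c), (c, 1)] i) := by
  unfold torusBlockSite torusUnit
  rw [add_assoc]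
  congr 1
  ext j
  fin_cases i <;> fin_cases j <;> simp

/-- **Matching the inner bonds = inner matching in block coordinates.** For the set `S` of the
four inner bonds of the block anchored at `x`, a leg configuration matches every bond of `S` iff,
read in block coordinates `p ↦ x + p`, its right legs of column `0` equal the left legs of
column `1` and its down legs of row `0` equal the up legs of row `1`. [folklore] -/
theorem forall_innerBond_iff {L : ℕ} (x : TorusSite 2 L) {S : Finset (TorusSite 2 L × Fin 2)}
    (hS : ∀ b, b ∈ S ↔ ∃ i c : Fin 2, b = (torusBlockSite L 2 2 x (![((0 : Fin 2), c), (c, 0)] i), i))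
    (G : TorusSite 2 L → Fin 2 → Fin 2 → Fin D) :
    (∀ b ∈ S, G b.1 b.2 1 = G (b.1 + torusUnit L b.2) b.2 0) ↔
      (∀ c : Fin 2, G (torusBlockSite L 2 2 x (0, c)) 0 1 = G (torusBlockSite L 2 2 x (1, c)) 0 0) ∧
      (∀ c : Fin 2, G (torusBlockSite L 2 2 x (c, 0)) 1 1 = G (torusBlockSite L 2 2 x (c, 1)) 1 0) := by
  constructor
  · intro h
    refine ⟨fun c => ?_, fun c => ?_⟩
    · have h0 := h _ ((hS _).2 ⟨0, c, rfl⟩)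
      rwa [torusBlockSite_innerBase_add_unit] at h0
    · have h1 := h _ ((hS _).2 ⟨1, c, rfl⟩)
      rwa [torusBlockSite_innerBase_add_unit] at h1
  · rintro ⟨hh, hv⟩ b hb
    obtain ⟨i, c, rfl⟩ := (hS b).1 hb
    dsimp only
    rw [torusBlockSite_innerBase_add_unit]
    fin_cases i
    · exact hh c
    · exact hv c

/-- Every leg of an inner bond of the block sits at a block site. [folklore] -/
theorem exists_eq_torusBlockSite_of_legBond_mem {L : ℕ} (x : TorusSite 2 L)
    {S : Finset (TorusSite 2 L × Fin 2)}
    (hS : ∀ b, b ∈ S ↔ ∃ i c : Fin 2, b = (torusBlockSite L 2 2 x (![((0 : Fin 2), c), (c, 0)] i), i))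
    {y : TorusSite 2 L} {i s : Fin 2} (h : (![y - torusUnit L i, y] s, i) ∈ S) :
    ∃ p : Fin 2 × Fin 2, y = torusBlockSite L 2 2 x p := by
  obtain ⟨i', c, h'⟩ := (hS _).1 h
  obtain ⟨h1, rfl⟩ := Prod.mk.inj h'
  fin_cases s
  · -- incoming leg: `y - e_i` is the base site, so `y` is the far site of the bond
    refine ⟨![((1 : Fin 2), c), (c, 1)] i, ?_⟩
    rw [← torusBlockSite_innerBase_add_unit, ← h1]
    simp
  · exact ⟨_, h1⟩

/-- **Inner and outer legs of the block.** The bond of the leg `(x + p, i, s)` of a block site is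
an inner bond iff the coordinate of `p` along the axis `i` differs from the side `s` (right legs
of column `0`, left legs of column `1`, down legs of row `0`, up legs of row `1`); it needs
`2 ≤ L` (injectivity of the anchor map). [folklore] -/
theorem legBond_torusBlockSite_mem_iff {L : ℕ} (hL : 2 ≤ L) (x : TorusSite 2 L)
    {S : Finset (TorusSite 2 L × Fin 2)}
    (hS : ∀ b, b ∈ S ↔ ∃ i c : Fin 2, b = (torusBlockSite L 2 2 x (![((0 : Fin 2), c), (c, 0)] i), i))
    (p : Fin 2 × Fin 2) (i s : Fin 2) :
    (![torusBlockSite L 2 2 x p - torusUnit L i, torusBlockSite L 2 2 x p] s, i) ∈ S ↔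
      ![p.1, p.2] i ≠ s := by
  have hinj := torusBlockSite_injective L 2 2 hL hL x
  -- the two legs of the inner bond with base offset `![(0,c),(c,0)] i`
  have hin1 : ∀ i c : Fin 2,
      (![torusBlockSite L 2 2 x (![((0 : Fin 2), c), (c, 0)] i) - torusUnit L i,
        torusBlockSite L 2 2 x (![((0 : Fin 2), c), (c, 0)] i)] 1, i) =
      (torusBlockSite L 2 2 x (![((0 : Fin 2), c), (c, 0)] i), i) := fun i c => rfl
  have hin0 : ∀ i c : Fin 2,
      (![torusBlockSite L 2 2 x (![((1 : Fin 2), c), (c, 1)] i) - torusUnit L i,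
        torusBlockSite L 2 2 x (![((1 : Fin 2), c), (c, 1)] i)] 0, i) =
      (torusBlockSite L 2 2 x (![((0 : Fin 2), c), (c, 0)] i), i) := fun i c => by
    rw [← torusBlockSite_innerBase_add_unit]
    simp
  rw [hS]
  obtain ⟨a, b⟩ := p
  constructor
  · rintro ⟨i', c, h'⟩
    obtain ⟨h1, rfl⟩ := Prod.mk.inj h'
    fin_cases s
    · -- incoming leg: `x + p = base + e_i` is the far site of an inner bond
      have h2 : torusBlockSite L 2 2 x (a, b) = torusBlockSite L 2 2 x (![((1 : Fin 2), c), (c, 1)] i) := by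
        rw [← torusBlockSite_innerBase_add_unit, ← h1]
        simp
      have h3 := hinj h2
      fin_cases i <;> simp_all
    · have h3 := hinj h1
      fin_cases i <;> simp_all
  · intro hne
    fin_cases i <;> fin_cases s <;> fin_cases a <;> fin_cases b <;> simp at hne <;>
      first
        | exact ⟨0, 0, hin0 0 0⟩ | exact ⟨0, 1, hin0 0 1⟩ | exact ⟨1, 0, hin0 1 0⟩
        | exact ⟨1, 1, hin0 1 1⟩ | exact ⟨0, 0, hin1 0 0⟩ | exact ⟨0, 1, hin1 0 1⟩
        | exact ⟨1, 0, hin1 1 0⟩ | exact ⟨1, 1, hin1 1 1⟩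

/-! ### The local term: `ker (1 - Π_𝒮) = 𝒮 = range Γ_R` -/

/-- The block map is additive in the boundary tensor. [folklore] -/
theorem pepsRect_add (n m : ℕ) (A : PEPSTensor q D) (X X' : PEPSBoundary D n m) :
    pepsRect n m A (X + X') = pepsRect n m A X + pepsRect n m A X' := by
  funext σ
  simp only [pepsRect, Pi.add_apply, mul_add, Finset.sum_add_distrib]

/-- The block map is homogeneous in the boundary tensor. [folklore] -/
theorem pepsRect_smul (n m : ℕ) (A : PEPSTensor q D) (c : ℂ) (X : PEPSBoundary D n m) :
    pepsRect n m A (c • X) = c • pepsRect n m A X := by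
  funext σ
  simp only [pepsRect, Pi.smul_apply, smul_eq_mul, Finset.mul_sum, mul_left_comm]

/-- The block map vanishes on the zero boundary tensor. [folklore] -/
theorem pepsRect_zero (n m : ℕ) (A : PEPSTensor q D) :
    pepsRect n m A (0 : PEPSBoundary D n m) = 0 := by
  funext σ
  simp [pepsRect]

/-- **`𝒮_{n×m}` is the range of the block map** (the span of the range of a linear map is its
range): every element of `pepsRange n m A` is a block state `ψ_X`. Pérez-García–Verstraete–Wolf–Cirac
(2008) §4 (`G_R = Γ_R(ℂ^{D^{|∂R|}})`). [cite: PerezGarciaVerstraeteWolfCirac2008PEPS, §4] -/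
theorem exists_boundary_of_mem_pepsRange {n m : ℕ} {A : PEPSTensor q D}
    {v : SpinSpace (Fin n × Fin m) q} (hv : v ∈ pepsRange n m A) :
    ∃ X : PEPSBoundary D n m, WithLp.toLp 2 (pepsRect n m A X) = v := by
  induction hv using Submodule.span_induction with
  | mem x hx =>
    obtain ⟨X, rfl⟩ := hx
    exact ⟨X, rfl⟩
  | zero => exact ⟨0, by rw [pepsRect_zero, WithLp.toLp_zero]⟩
  | add x y _ _ hx hy =>
    obtain ⟨X, rfl⟩ := hx
    obtain ⟨Y, rfl⟩ := hy
    exact ⟨X + Y, by rw [pepsRect_add, WithLp.toLp_add]⟩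
  | smul c x _ hx =>
    obtain ⟨X, rfl⟩ := hx
    exact ⟨c • X, by rw [pepsRect_smul, WithLp.toLp_smul]⟩

/-- **`ker h ⊇ 𝒮`**: the local term `h = 1 - Π_𝒮` (the orthogonal projection onto `𝒮ᗮ`)
annihilates every block state `ψ_X`. Pérez-García–Verstraete–Wolf–Cirac (2008) §3 (`ker h = S_R`).
[cite: PerezGarciaVerstraeteWolfCirac2008PEPS, §3] -/
theorem pepsLocalTerm_mulVec_pepsRect (n m : ℕ) (A : PEPSTensor q D) (X : PEPSBoundary D n m) :
    pepsLocalTerm n m A *ᵥ pepsRect n m A X = 0 := by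
  have hmem : WithLp.toLp 2 (pepsRect n m A X) ∈ pepsRange n m A :=
    Submodule.subset_span ⟨X, rfl⟩
  have hP := projMatrix_mulVec (pepsRange n m A)ᗮ (WithLp.toLp 2 (pepsRect n m A X))
  rw [Submodule.starProjection_orthogonal_apply_eq_zero hmem] at hP
  unfold pepsLocalTerm
  simpa using hP

/-- **`ker h ⊆ 𝒮`**: a block vector annihilated by `h = 1 - Π_𝒮` lies in `𝒮 = 𝒮ᗮᗮ`, hence is
a block state `ψ_X`. Pérez-García–Verstraete–Wolf–Cirac (2008) §3 (`ker h = S_R`);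
Schuch–Cirac–Pérez-García (2010) Thm. 5.7 (`h_{i,j} = 1 - Π_{𝒮_{2×2}}`).
[cite: PerezGarciaVerstraeteWolfCirac2008PEPS, §3] -/
theorem exists_pepsRect_of_pepsLocalTerm_mulVec_eq_zero (n m : ℕ) (A : PEPSTensor q D)
    (u : TensorIndex (Fin n × Fin m) q → ℂ) (hu : pepsLocalTerm n m A *ᵥ u = 0) :
    ∃ X : PEPSBoundary D n m, pepsRect n m A X = u := by
  have hP := projMatrix_mulVec (pepsRange n m A)ᗮ (WithLp.toLp 2 u)
  have h0 : ((pepsRange n m A)ᗮ.starProjection (WithLp.toLp 2 u) :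
      TensorIndex (Fin n × Fin m) q → ℂ) = 0 := by
    rw [← hP]
    exact hu
  have h1 : (pepsRange n m A)ᗮ.starProjection (WithLp.toLp 2 u) = 0 :=
    WithLp.ofLp_injective 2 (by rw [WithLp.ofLp_zero]; exact h0)
  rw [Submodule.starProjection_apply_eq_zero_iff, Submodule.orthogonal_orthogonal] at h1
  obtain ⟨X, hX⟩ := exists_boundary_of_mem_pepsRange h1
  exact ⟨X, congrArg WithLp.ofLp hX⟩

/-! ### Zero-energy vectors: every `2 × 2` block slice is a block state, and conversely -/

/-- **`H ψ = 0 ⇒` every block slice of `ψ` lies in `𝒮_{2×2}`.** For `2 ≤ L`, if the parent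
Hamiltonian `Σ_x h_x` kills `ψ`, then each (positive) term does (`mulVec_eq_zero_of_sum_posSemidef`),
`h_x = (1 - Π_𝒮) ⊗ 𝟙` acts by `1 - Π_𝒮` on the slices of `ψ` along the block at `x`
(`localOp_mulVec_extend_val`, relabelled along the anchor bijection `p ↦ x + p`), and
`ker (1 - Π_𝒮) = 𝒮 = {ψ_X}`. This is "the null space of a sum of projectors is the intersection"
in the proof of Schuch–Cirac–Pérez-García (2010) Thm. 5.7 (with Thm. 3.5).
[cite: SchuchCiracPerezGarcia2010, Thm. 5.7] -/
theorem exists_boundary_of_pepsParentHamiltonian_mulVec_eq_zero (L : ℕ) [NeZero L] (hL : 2 ≤ L)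
    (A : PEPSTensor q D) (ψ : TensorIndex (TorusSite 2 L) q → ℂ)
    (h0 : pepsParentHamiltonian L 2 2 A *ᵥ ψ = 0) (x : TorusSite 2 L)
    (σ : TensorIndex (TorusSite 2 L) q) :
    ∃ X : PEPSBoundary D 2 2, ∀ β : torusBlock L 2 2 x → Fin q,
      ψ (Subtype.val.extend β σ) = pepsRect 2 2 A X (fun p => β (torusBlockElem L 2 2 x p)) := by
  -- the block term at `x` kills `ψ`
  have hx : localOp (torusBlock L 2 2 x) (onTorusBlock L 2 2 x (pepsLocalTerm 2 2 A)) *ᵥ ψ = 0 := by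
    unfold pepsParentHamiltonian at h0
    exact mulVec_eq_zero_of_sum_posSemidef (fun y _ => posSemidef_localOp _
      ((pepsLocalTerm_posSemidef 2 2 A).submatrix _)) h0 x (Finset.mem_univ x)
  have hf : Function.Bijective fun (β : torusBlock L 2 2 x → Fin q) (p : Fin 2 × Fin 2) =>
      β (torusBlockElem L 2 2 x p) :=
    (torusBlockElem_bijective L 2 2 hL hL x).comp_right
  set g := Equiv.ofBijective _ hf with hg
  have hslice := localOp_mulVec_extend_val (torusBlock L 2 2 x)
    (onTorusBlock L 2 2 x (pepsLocalTerm 2 2 A)) ψ σ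
  rw [hx] at hslice
  have hker : pepsLocalTerm 2 2 A *ᵥ
      ((fun β : torusBlock L 2 2 x → Fin q => ψ (Subtype.val.extend β σ)) ∘ g.symm) = 0 := by
    have h2 : (pepsLocalTerm 2 2 A).submatrix g g *ᵥ
        (fun β : torusBlock L 2 2 x → Fin q => ψ (Subtype.val.extend β σ)) = 0 := hslice.symm
    rw [submatrix_mulVec_equiv] at h2
    funext w
    have h3 := congrFun h2 (g.symm w)
    simpa using h3
  obtain ⟨X, hX⟩ := exists_pepsRect_of_pepsLocalTerm_mulVec_eq_zero 2 2 A _ hker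
  refine ⟨X, fun β => ?_⟩
  have h4 := congrFun hX (g β)
  simp only [Function.comp_apply, Equiv.symm_apply_apply] at h4
  exact h4.symm

/-- **Every block slice in `𝒮_{2×2}` ⇒ the block term kills the vector** (frustration-freeness,
the easy inclusion in Schuch–Cirac–Pérez-García (2010) Thm. 5.7): if along the block at `x` every
slice of `φ` is a block state `ψ_X`, then `h_x φ = ((1 - Π_𝒮) ⊗ 𝟙) φ = 0`.
[cite: SchuchCiracPerezGarcia2010, Thm. 5.7] -/
theorem localOp_torusBlock_mulVec_eq_zero (L : ℕ) [NeZero L] (hL : 2 ≤ L) (A : PEPSTensor q D)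
    (x : TorusSite 2 L) (φ : TensorIndex (TorusSite 2 L) q → ℂ)
    (hφ : ∀ σ : TensorIndex (TorusSite 2 L) q, ∃ X : PEPSBoundary D 2 2,
      ∀ β : torusBlock L 2 2 x → Fin q,
        φ (Subtype.val.extend β σ) = pepsRect 2 2 A X (fun p => β (torusBlockElem L 2 2 x p))) :
    localOp (torusBlock L 2 2 x) (onTorusBlock L 2 2 x (pepsLocalTerm 2 2 A)) *ᵥ φ = 0 := by
  funext σ
  rw [localOp_mulVec_apply, Pi.zero_apply]
  obtain ⟨X, hX⟩ := hφ σ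
  have hf : Function.Bijective fun (β : torusBlock L 2 2 x → Fin q) (p : Fin 2 × Fin 2) =>
      β (torusBlockElem L 2 2 x p) :=
    (torusBlockElem_bijective L 2 2 hL hL x).comp_right
  set g := Equiv.ofBijective _ hf with hg
  have hv : (fun β : torusBlock L 2 2 x → Fin q => φ (Subtype.val.extend β σ)) =
      pepsRect 2 2 A X ∘ g := funext hX
  rw [hv]
  change ((pepsLocalTerm 2 2 A).submatrix g g *ᵥ (pepsRect 2 2 A X ∘ g)) _ = 0
  rw [submatrix_mulVec_equiv, Function.comp_assoc, Equiv.self_comp_symm, Function.comp_id,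
    pepsLocalTerm_mulVec_pepsRect]
  rfl

/-! ### Splitting configurations along a block -/

/-- Summing over all configurations = summing over the configurations off `B` and, inside, over
the configurations of `B` (the product structure `(Λ → α) ≃ (B → α) × (Λ∖B → α)`,
`Equiv.piEquivPiSubtypeProd`). [folklore] -/
theorem sum_eq_sum_offBlock_sum_block {Λ' α M : Type*} [Fintype Λ'] [DecidableEq Λ'] [Fintype α]
    [AddCommMonoid M] (B : Finset Λ') (F : (Λ' → α) → M) :
    ∑ σ : Λ' → α, F σ = ∑ γ : {y // y ∉ B} → α, ∑ β : B → α,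
      F (fun y => if h : y ∈ B then β ⟨y, h⟩ else γ ⟨y, h⟩) := by
  rw [← (Equiv.piEquivPiSubtypeProd (· ∈ B) (fun _ => α)).symm.sum_comp, Fintype.sum_prod_type,
    Finset.sum_comm]
  rfl

/-- A product over all sites of a function of a glued configuration splits into the block part
and the off-block part. [folklore] -/
theorem prod_glue_eq {Λ' α M : Type*} [Fintype Λ'] [DecidableEq Λ'] [CommMonoid M]
    (B : Finset Λ') (f : Λ' → α → M) (β : B → α) (γ : {y // y ∉ B} → α) :
    ∏ y, f y (if h : y ∈ B then β ⟨y, h⟩ else γ ⟨y, h⟩) =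
      (∏ y : B, f y (β y)) * ∏ y : {y // y ∉ B}, f y (γ y) := by
  rw [← Fintype.prod_subtype_mul_prod_subtype (· ∈ B)]
  congr 1
  · exact Finset.prod_congr (by ext y; simp only [Finset.mem_univ]) fun y _ => by rw [dif_pos y.2]
  · exact Finset.prod_congr (by ext y; simp only [Finset.mem_univ]) fun y _ => by rw [dif_neg y.2]

/-- A glued configuration is the `Subtype.val.extend` of its block part into any configuration
with the same off-block part. [folklore] -/
theorem glue_eq_extend_val {Λ' α : Type*} [DecidableEq Λ'] (B : Finset Λ') (β β₁ : B → α)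
    (γ : {y // y ∉ B} → α) :
    (fun y => if h : y ∈ B then β ⟨y, h⟩ else γ ⟨y, h⟩) =
      Subtype.val.extend β (fun y => if h : y ∈ B then β₁ ⟨y, h⟩ else γ ⟨y, h⟩) := by
  funext y
  by_cases hy : y ∈ B
  · rw [dif_pos hy, Function.extend_val_apply hy]
  · rw [dif_neg hy, Function.extend_val_apply' hy, dif_neg hy]

/-! ### `T^{⊗Λ} ψ` lies in `V_{S_x}` when the slices of `ψ` along the block at `x` are block states -/

/-- **`T^{⊗4}` of a block state is its virtual tensor** (on the block of the torus anchored at `x`,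
`2 ≤ L`): `Σ_β (Π_{y ∈ B} t(G_y, β_y)) ψ_X(β ∘ (p ↦ x + p)) = [inner bonds of G match] · X(outer legs
of G)`, by `pepsRect_two_two_eq_sum_legs` and `T ∘ 𝒫 = id` (`virtual_leftInverse`).
Schuch–Cirac–Pérez-García (2010), proof of Thm. 5.4 ("we apply the left inverse … and obtain …").
[cite: SchuchCiracPerezGarcia2010, Thm. 5.4] -/
theorem sum_block_leftInverse_pepsRect (L : ℕ) [NeZero L] (hL : 2 ≤ L) (A : PEPSTensor q D)
    (t : (Fin 2 → Fin 2 → Fin D) → Fin q → ℂ)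
    (ht : ∀ g g' : Fin 2 → Fin 2 → Fin D,
      ∑ s, t g s * A s (g' 0 0) (g' 1 0) (g' 0 1) (g' 1 1) = if g = g' then 1 else 0)
    (x : TorusSite 2 L) (X : PEPSBoundary D 2 2) (G : TorusSite 2 L → Fin 2 → Fin 2 → Fin D) :
    ∑ β : torusBlock L 2 2 x → Fin q, (∏ y : torusBlock L 2 2 x, t (G y) (β y)) *
        pepsRect 2 2 A X (fun p => β (torusBlockElem L 2 2 x p)) =
      if (∀ c : Fin 2, G (torusBlockSite L 2 2 x (0, c)) 0 1 = G (torusBlockSite L 2 2 x (1, c)) 0 0) ∧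
          (∀ c : Fin 2, G (torusBlockSite L 2 2 x (c, 0)) 1 1 = G (torusBlockSite L 2 2 x (c, 1)) 1 0)
      then X (fun b => G (torusBlockSite L 2 2 x (0, b)) 0 0)
        (fun a => G (torusBlockSite L 2 2 x (a, 0)) 1 0)
        (fun b => G (torusBlockSite L 2 2 x (1, b)) 0 1)
        (fun a => G (torusBlockSite L 2 2 x (a, 1)) 1 1) else 0 := by
  have hbij := torusBlockElem_bijective L 2 2 hL hL x
  have hf : Function.Bijective fun (β : torusBlock L 2 2 x → Fin q) (p : Fin 2 × Fin 2) =>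
      β (torusBlockElem L 2 2 x p) := hbij.comp_right
  set g := Equiv.ofBijective _ hf with hg
  rw [← g.symm.sum_comp]
  have h1 : ∀ ρ : Fin 2 × Fin 2 → Fin q,
      (∏ y : torusBlock L 2 2 x, t (G y) (g.symm ρ y)) =
        ∏ p : Fin 2 × Fin 2, t (G (torusBlockSite L 2 2 x p)) (ρ p) := by
    intro ρ
    symm
    refine Fintype.prod_bijective _ hbij _ _ fun p => ?_
    have h := congrFun (g.apply_symm_apply ρ) p
    simp only [hg, Equiv.ofBijective_apply] at h
    rw [← h]
    rfl
  have h2 : ∀ ρ : Fin 2 × Fin 2 → Fin q,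
      (fun p => g.symm ρ (torusBlockElem L 2 2 x p)) = ρ := fun ρ => g.apply_symm_apply ρ
  have hite : ∀ (P : Prop) [Decidable P] (a b : ℂ),
      (if P then a * b else 0) = a * (if P then b else 0) := by
    intros
    split_ifs <;> simp
  have h3 : ∀ ρ : Fin 2 × Fin 2 → Fin q,
      (fun β : torusBlock L 2 2 x → Fin q => (∏ y : torusBlock L 2 2 x, t (G y) (β y)) *
        pepsRect 2 2 A X (fun p => β (torusBlockElem L 2 2 x p))) (g.symm ρ) =
      (∏ p : Fin 2 × Fin 2, t (G (torusBlockSite L 2 2 x p)) (ρ p)) *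
        ∑ G' : Fin 2 × Fin 2 → Fin 2 → Fin 2 → Fin D,
          (∏ p, A (ρ p) (G' p 0 0) (G' p 1 0) (G' p 0 1) (G' p 1 1)) *
            (if (∀ b : Fin 2, G' (0, b) 0 1 = G' (1, b) 0 0) ∧
                (∀ a : Fin 2, G' (a, 0) 1 1 = G' (a, 1) 1 0)
              then X (fun b => G' (0, b) 0 0) (fun a => G' (a, 0) 1 0) (fun b => G' (1, b) 0 1)
                (fun a => G' (a, 1) 1 1) else 0) := by
    intro ρ
    dsimp only
    rw [h1 ρ, h2 ρ, pepsRect_two_two_eq_sum_legs]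
    simp only [hite]
  simp only [h3]
  exact virtual_leftInverse A t ht _ (fun p => G (torusBlockSite L 2 2 x p))

/-- **`T^{⊗Λ} ψ` along a block.** If every slice of `ψ` along the block `B` at `x` is a block
state, `ψ(β ⊔ γ) = ψ_{X(γ)}(β ∘ (p ↦ x + p))`, then
`(T^{⊗Λ} ψ)(G) = Σ_γ (Π_{y ∉ B} t(G_y, γ_y)) · [inner bonds of G|_B match] · X(γ)(outer legs of G|_B)`:
split the configuration sum along `B` and use `sum_block_leftInverse_pepsRect`.
Schuch–Cirac–Pérez-García (2010), proof of Thm. 5.4. [cite: SchuchCiracPerezGarcia2010, Thm. 5.4] -/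
theorem virtualT_eq_sum_offBlock (L : ℕ) [NeZero L] (hL : 2 ≤ L) (A : PEPSTensor q D)
    (t : (Fin 2 → Fin 2 → Fin D) → Fin q → ℂ)
    (ht : ∀ g g' : Fin 2 → Fin 2 → Fin D,
      ∑ s, t g s * A s (g' 0 0) (g' 1 0) (g' 0 1) (g' 1 1) = if g = g' then 1 else 0)
    (x : TorusSite 2 L) (ψ : TensorIndex (TorusSite 2 L) q → ℂ)
    (Xf : ({y // y ∉ torusBlock L 2 2 x} → Fin q) → PEPSBoundary D 2 2)
    (hXf : ∀ (γ : {y // y ∉ torusBlock L 2 2 x} → Fin q) (β : torusBlock L 2 2 x → Fin q),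
      ψ (fun y => if h : y ∈ torusBlock L 2 2 x then β ⟨y, h⟩ else γ ⟨y, h⟩) =
        pepsRect 2 2 A (Xf γ) (fun p => β (torusBlockElem L 2 2 x p)))
    (G : TorusSite 2 L → Fin 2 → Fin 2 → Fin D) :
    ∑ σ : TensorIndex (TorusSite 2 L) q, (∏ y, t (G y) (σ y)) * ψ σ =
      ∑ γ : {y // y ∉ torusBlock L 2 2 x} → Fin q,
        (∏ y : {y // y ∉ torusBlock L 2 2 x}, t (G y) (γ y)) *
        (if (∀ c : Fin 2, G (torusBlockSite L 2 2 x (0, c)) 0 1 = G (torusBlockSite L 2 2 x (1, c)) 0 0) ∧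
            (∀ c : Fin 2, G (torusBlockSite L 2 2 x (c, 0)) 1 1 = G (torusBlockSite L 2 2 x (c, 1)) 1 0)
          then Xf γ (fun b => G (torusBlockSite L 2 2 x (0, b)) 0 0)
            (fun a => G (torusBlockSite L 2 2 x (a, 0)) 1 0)
            (fun b => G (torusBlockSite L 2 2 x (1, b)) 0 1)
            (fun a => G (torusBlockSite L 2 2 x (a, 1)) 1 1) else 0) := by
  rw [sum_eq_sum_offBlock_sum_block (torusBlock L 2 2 x)]
  refine Finset.sum_congr rfl fun γ _ => ?_
  simp only [prod_glue_eq (torusBlock L 2 2 x) (fun y s => t (G y) s), hXf]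
  rw [← sum_block_leftInverse_pepsRect L hL A t ht x (Xf γ) G, Finset.mul_sum]
  refine Finset.sum_congr rfl fun β _ => ?_
  ring

/-- **`T^{⊗Λ} ψ ∈ V_{S_x}`** (Schuch–Cirac–Pérez-García (2010), proof of Thm. 5.4, applied to a
zero-energy vector): if every slice of `ψ` along the block at `x` is a block state, then the
virtual tensor `Φ = T^{⊗Λ} ψ` vanishes unless the four inner bonds `S_x` of the block match, and
is unchanged when the legs of those bonds are changed (matched): by `virtualT_eq_sum_offBlock`,
`Φ(G)` only sees `G` off the block and the outer legs of the block, whose bonds are not in `S_x`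
(`legBond_torusBlockSite_mem_iff`, `exists_eq_torusBlockSite_of_legBond_mem`). Needs `0 < q`
(a reference block configuration) and `2 ≤ L`. [cite: SchuchCiracPerezGarcia2010, Thm. 5.4] -/
theorem virtualT_mem_bondSpace (L : ℕ) [NeZero L] (hL : 2 ≤ L) (hq : 0 < q) (A : PEPSTensor q D)
    (t : (Fin 2 → Fin 2 → Fin D) → Fin q → ℂ)
    (ht : ∀ g g' : Fin 2 → Fin 2 → Fin D,
      ∑ s, t g s * A s (g' 0 0) (g' 1 0) (g' 0 1) (g' 1 1) = if g = g' then 1 else 0)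
    (x : TorusSite 2 L) (ψ : TensorIndex (TorusSite 2 L) q → ℂ)
    (hψ : ∀ σ : TensorIndex (TorusSite 2 L) q, ∃ X : PEPSBoundary D 2 2,
      ∀ β : torusBlock L 2 2 x → Fin q,
        ψ (Subtype.val.extend β σ) = pepsRect 2 2 A X (fun p => β (torusBlockElem L 2 2 x p)))
    {S : Finset (TorusSite 2 L × Fin 2)}
    (hS : ∀ b, b ∈ S ↔ ∃ i c : Fin 2, b = (torusBlockSite L 2 2 x (![((0 : Fin 2), c), (c, 0)] i), i)) :
    (∀ G : TorusSite 2 L → Fin 2 → Fin 2 → Fin D,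
        (∃ b ∈ S, G b.1 b.2 1 ≠ G (b.1 + torusUnit L b.2) b.2 0) →
        (∑ σ : TensorIndex (TorusSite 2 L) q, (∏ y, t (G y) (σ y)) * ψ σ) = 0) ∧
    (∀ G G' : TorusSite 2 L → Fin 2 → Fin 2 → Fin D,
      (∀ b ∈ S, G b.1 b.2 1 = G (b.1 + torusUnit L b.2) b.2 0) →
      (∀ b ∈ S, G' b.1 b.2 1 = G' (b.1 + torusUnit L b.2) b.2 0) →
      (∀ y i s, (![y - torusUnit L i, y] s, i) ∉ S → G y i s = G' y i s) →
      (∑ σ : TensorIndex (TorusSite 2 L) q, (∏ y, t (G y) (σ y)) * ψ σ) =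
        ∑ σ : TensorIndex (TorusSite 2 L) q, (∏ y, t (G' y) (σ y)) * ψ σ) := by
  -- boundary tensors as a function of the off-block configuration
  let β₁ : torusBlock L 2 2 x → Fin q := fun _ => ⟨0, hq⟩
  have hψ' : ∀ γ : {y // y ∉ torusBlock L 2 2 x} → Fin q, ∃ X : PEPSBoundary D 2 2,
      ∀ β : torusBlock L 2 2 x → Fin q,
        ψ (fun y => if h : y ∈ torusBlock L 2 2 x then β ⟨y, h⟩ else γ ⟨y, h⟩) =
          pepsRect 2 2 A X (fun p => β (torusBlockElem L 2 2 x p)) := by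
    intro γ
    obtain ⟨X, hX⟩ := hψ (fun y => if h : y ∈ torusBlock L 2 2 x then β₁ ⟨y, h⟩ else γ ⟨y, h⟩)
    refine ⟨X, fun β => ?_⟩
    rw [glue_eq_extend_val (torusBlock L 2 2 x) β β₁ γ, hX β]
  choose Xf hXf using hψ'
  have hformula := virtualT_eq_sum_offBlock L hL A t ht x ψ Xf hXf
  -- legs off the block and outer legs of the block have bonds outside `S`
  have hoff : ∀ G G' : TorusSite 2 L → Fin 2 → Fin 2 → Fin D,
      (∀ y i s, (![y - torusUnit L i, y] s, i) ∉ S → G y i s = G' y i s) →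
      ∀ y : {y // y ∉ torusBlock L 2 2 x}, G y = G' y := by
    intro G G' hGG' y
    funext i s
    refine hGG' y i s fun hmem => y.2 ?_
    obtain ⟨p, hp⟩ := exists_eq_torusBlockSite_of_legBond_mem x hS hmem
    rw [hp]
    exact Finset.mem_image_of_mem _ (Finset.mem_univ p)
  have houter : ∀ G G' : TorusSite 2 L → Fin 2 → Fin 2 → Fin D,
      (∀ y i s, (![y - torusUnit L i, y] s, i) ∉ S → G y i s = G' y i s) →
      (fun b : Fin 2 => G (torusBlockSite L 2 2 x (0, b)) 0 0) =
          (fun b : Fin 2 => G' (torusBlockSite L 2 2 x (0, b)) 0 0) ∧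
      (fun a : Fin 2 => G (torusBlockSite L 2 2 x (a, 0)) 1 0) =
          (fun a : Fin 2 => G' (torusBlockSite L 2 2 x (a, 0)) 1 0) ∧
      (fun b : Fin 2 => G (torusBlockSite L 2 2 x (1, b)) 0 1) =
          (fun b : Fin 2 => G' (torusBlockSite L 2 2 x (1, b)) 0 1) ∧
      (fun a : Fin 2 => G (torusBlockSite L 2 2 x (a, 1)) 1 1) =
          (fun a : Fin 2 => G' (torusBlockSite L 2 2 x (a, 1)) 1 1) := by
    intro G G' hGG'
    refine ⟨funext fun b => hGG' _ _ _ fun h => ?_, funext fun a => hGG' _ _ _ fun h => ?_,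
      funext fun b => hGG' _ _ _ fun h => ?_, funext fun a => hGG' _ _ _ fun h => ?_⟩ <;>
      rw [legBond_torusBlockSite_mem_iff hL x hS] at h <;> simp at h
  refine ⟨fun G ⟨b, hb, hne⟩ => ?_, fun G G' hG hG' hGG' => ?_⟩
  · rw [hformula]
    refine Finset.sum_eq_zero fun γ _ => ?_
    rw [if_neg fun hin => hne ((forall_innerBond_iff x hS G).2 hin b hb), mul_zero]
  · rw [hformula G, hformula G']
    refine Finset.sum_congr rfl fun γ _ => ?_
    obtain ⟨h00, h10, h01, h11⟩ := houter G G' hGG'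
    rw [if_pos ((forall_innerBond_iff x hS G).1 hG), if_pos ((forall_innerBond_iff x hS G').1 hG'),
      h00, h10, h01, h11]
    congr 1
    exact Finset.prod_congr rfl fun y _ => by rw [hoff G G' hGG' y]

/-! ### `ψ = 𝒫^{⊗Λ} T^{⊗Λ} ψ`: the single-site projector `𝒫(A) T` fixes a zero-energy vector -/

/-- Updating a configuration at a block site is gluing the updated block restriction. [folklore] -/
theorem update_eq_extend_val_update {Λ' α : Type*} [DecidableEq Λ'] (B : Finset Λ') (σ : Λ' → α)
    {y : Λ'} (hy : y ∈ B) (s : α) :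
    Function.update σ y s = Subtype.val.extend (Function.update (fun z : B => σ z) ⟨y, hy⟩ s) σ := by
  funext z
  by_cases hz : z ∈ B
  · rw [Function.extend_val_apply hz]
    by_cases hzy : z = y
    · subst hzy
      rw [Function.update_self, Function.update_self]
    · rw [Function.update_of_ne hzy, Function.update_of_ne fun h => hzy (congrArg Subtype.val h)]
  · rw [Function.extend_val_apply' hz, Function.update_of_ne]
    rintro rfl
    exact hz hy

/-- **The single-site projector fixes states in the range of `𝒫^{⊗R}`**: with `π = 𝒫(A) T`
(`π(s, s') = Σ_g A^s_g t(g, s')`, and `T 𝒫 = id`), applying `π` at one site `p₀` of a region to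
`𝒫^{⊗R} Φ` gives back `𝒫^{⊗R} Φ`, since `Σ_{s'} π(s, s') A^{s'}_g = A^s_g`. [folklore] -/
theorem sum_pi_mul_virtualP_update {R : Type*} [Fintype R] [DecidableEq R] (A : PEPSTensor q D)
    (t : (Fin 2 → Fin 2 → Fin D) → Fin q → ℂ)
    (ht : ∀ g g' : Fin 2 → Fin 2 → Fin D,
      ∑ s, t g s * A s (g' 0 0) (g' 1 0) (g' 0 1) (g' 1 1) = if g = g' then 1 else 0)
    (Φ : (R → Fin 2 → Fin 2 → Fin D) → ℂ) (ρ : R → Fin q) (p₀ : R) :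
    ∑ s : Fin q, (∑ g : Fin 2 → Fin 2 → Fin D, A (ρ p₀) (g 0 0) (g 1 0) (g 0 1) (g 1 1) * t g s) *
        ∑ G : R → Fin 2 → Fin 2 → Fin D,
          (∏ p, A (Function.update ρ p₀ s p) (G p 0 0) (G p 1 0) (G p 0 1) (G p 1 1)) * Φ G =
      ∑ G : R → Fin 2 → Fin 2 → Fin D, (∏ p, A (ρ p) (G p 0 0) (G p 1 0) (G p 0 1) (G p 1 1)) * Φ G := by
  -- `Σ_{s'} π(s, s') A^{s'}_g = A^s_g`
  have hπ : ∀ (s : Fin q) (g : Fin 2 → Fin 2 → Fin D),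
      ∑ s', (∑ g', A s (g' 0 0) (g' 1 0) (g' 0 1) (g' 1 1) * t g' s') *
        A s' (g 0 0) (g 1 0) (g 0 1) (g 1 1) = A s (g 0 0) (g 1 0) (g 0 1) (g 1 1) := by
    intro s g
    simp only [Finset.sum_mul, mul_assoc]
    rw [Finset.sum_comm]
    simp only [← Finset.mul_sum, ht, mul_ite, mul_one, mul_zero, Finset.sum_ite_eq',
      Finset.mem_univ, if_true]
  -- expand the factor at `p₀`
  have hexp : ∀ (s : Fin q) (G : R → Fin 2 → Fin 2 → Fin D),
      (∏ p, A (Function.update ρ p₀ s p) (G p 0 0) (G p 1 0) (G p 0 1) (G p 1 1)) =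
        A s (G p₀ 0 0) (G p₀ 1 0) (G p₀ 0 1) (G p₀ 1 1) *
          ∏ p ∈ Finset.univ.erase p₀, A (ρ p) (G p 0 0) (G p 1 0) (G p 0 1) (G p 1 1) := by
    intro s G
    rw [← Finset.mul_prod_erase _ _ (Finset.mem_univ p₀), Function.update_self]
    congr 1
    exact Finset.prod_congr rfl fun p hp => by rw [Function.update_of_ne (Finset.ne_of_mem_erase hp)]
  simp only [hexp, Finset.mul_sum]
  rw [Finset.sum_comm]
  refine Finset.sum_congr rfl fun G _ => ?_
  simp only [← mul_assoc, ← Finset.sum_mul, hπ]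
  congr 1
  exact Finset.mul_prod_erase Finset.univ
    (fun p => A (ρ p) (G p 0 0) (G p 1 0) (G p 0 1) (G p 1 1)) (Finset.mem_univ p₀)

/-- **A zero-energy vector is fixed by the single-site projector `π = 𝒫(A) T` at every site**:
the site `y` is the anchor of the block at `y`, the slice of `ψ` along that block is a block state
`ψ_X = 𝒫^{⊗4}(δ_inner X)`, and `π 𝒫 = 𝒫` sitewise (`sum_pi_mul_virtualP_update`).
Schuch–Cirac–Pérez-García (2010) Def. 3.1 (the left inverse). [cite: SchuchCiracPerezGarcia2010, Def. 3.1] -/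
theorem sum_pi_update_eq_self_of_slices (L : ℕ) [NeZero L] (hL : 2 ≤ L) (A : PEPSTensor q D)
    (t : (Fin 2 → Fin 2 → Fin D) → Fin q → ℂ)
    (ht : ∀ g g' : Fin 2 → Fin 2 → Fin D,
      ∑ s, t g s * A s (g' 0 0) (g' 1 0) (g' 0 1) (g' 1 1) = if g = g' then 1 else 0)
    (ψ : TensorIndex (TorusSite 2 L) q → ℂ)
    (hψ : ∀ (x : TorusSite 2 L) (σ : TensorIndex (TorusSite 2 L) q), ∃ X : PEPSBoundary D 2 2,
      ∀ β : torusBlock L 2 2 x → Fin q,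
        ψ (Subtype.val.extend β σ) = pepsRect 2 2 A X (fun p => β (torusBlockElem L 2 2 x p)))
    (y : TorusSite 2 L) (σ : TensorIndex (TorusSite 2 L) q) :
    ∑ s : Fin q, (∑ g : Fin 2 → Fin 2 → Fin D, A (σ y) (g 0 0) (g 1 0) (g 0 1) (g 1 1) * t g s) *
      ψ (Function.update σ y s) = ψ σ := by
  have hy0 : torusBlockSite L 2 2 y (0, 0) = y := torusBlockSite_zero_zero L 1 1 y
  have hy : y ∈ torusBlock L 2 2 y := Finset.mem_image.2 ⟨(0, 0), Finset.mem_univ _, hy0⟩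
  have helem : torusBlockElem L 2 2 y (0, 0) = ⟨y, hy⟩ := Subtype.ext hy0
  have hinj : Function.Injective (torusBlockElem L 2 2 y) :=
    (torusBlockElem_bijective L 2 2 hL hL y).1
  obtain ⟨X, hX⟩ := hψ y σ
  -- the block configuration of `σ`
  set ρ : Fin 2 × Fin 2 → Fin q := fun p => σ (torusBlockSite L 2 2 y p) with hρ
  have hσ : ψ σ = pepsRect 2 2 A X ρ := by
    conv_lhs => rw [← extend_val_restrict (torusBlock L 2 2 y) σ]
    exact hX _
  have hupd : ∀ s, ψ (Function.update σ y s) = pepsRect 2 2 A X (Function.update ρ (0, 0) s) := by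
    intro s
    rw [update_eq_extend_val_update (torusBlock L 2 2 y) σ hy s, hX]
    congr 1
    rw [← helem]
    exact Function.update_comp_eq_of_injective' (fun z : torusBlock L 2 2 y => σ z) hinj (0, 0) s
  have hρ0 : σ y = ρ (0, 0) := by
    change σ y = σ (torusBlockSite L 2 2 y (0, 0))
    rw [hy0]
  simp only [hupd, hσ, hρ0, pepsRect_two_two_eq_sum_legs]
  have hite : ∀ (P : Prop) [Decidable P] (a b : ℂ),
      (if P then a * b else 0) = a * (if P then b else 0) := by
    intros
    split_ifs <;> simp
  simp only [hite]
  exact sum_pi_mul_virtualP_update A t ht _ ρ (0, 0)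

/-! ### `𝒫^{⊗Λ}(V_{S_x})` has block-state slices (the easy inclusion of Thm. 5.4 / frustration-freeness) -/

/-- **Slices of `𝒫^{⊗Λ} Φ` for `Φ ∈ V_{S_x}` are block states.** If a virtual tensor `Φ` vanishes
off the `S_x`-matched configurations and is invariant under matched changes of the legs of `S_x`
(the four inner bonds of the block at `x`), then along that block every slice of `𝒫^{⊗Λ} Φ` is
`ψ_X` for a boundary tensor `X` depending only on the off-block configuration: split the leg sum
along the block; the inner sum is `𝒫^{⊗4}` of "`δ_inner` times a function of the outer legs",
which is `ψ_X` by `pepsRect_two_two_eq_sum_legs`. This is the inclusion "`{ζ(X)} ⊆` each local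
space" in Schuch–Cirac–Pérez-García (2010) Thm. 5.4 / the frustration-freeness in Thm. 5.7.
[cite: SchuchCiracPerezGarcia2010, Thm. 5.4 and Thm. 5.7] -/
theorem exists_pepsRect_slice_virtualP (L : ℕ) [NeZero L] (hL : 2 ≤ L) (A : PEPSTensor q D)
    (x : TorusSite 2 L) {S : Finset (TorusSite 2 L × Fin 2)}
    (hS : ∀ b, b ∈ S ↔ ∃ i c : Fin 2, b = (torusBlockSite L 2 2 x (![((0 : Fin 2), c), (c, 0)] i), i))
    (Φ : (TorusSite 2 L → Fin 2 → Fin 2 → Fin D) → ℂ)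
    (h1 : ∀ G : TorusSite 2 L → Fin 2 → Fin 2 → Fin D,
      (∃ b ∈ S, G b.1 b.2 1 ≠ G (b.1 + torusUnit L b.2) b.2 0) → Φ G = 0)
    (h2 : ∀ G G' : TorusSite 2 L → Fin 2 → Fin 2 → Fin D,
      (∀ b ∈ S, G b.1 b.2 1 = G (b.1 + torusUnit L b.2) b.2 0) →
      (∀ b ∈ S, G' b.1 b.2 1 = G' (b.1 + torusUnit L b.2) b.2 0) →
      (∀ y i s, (![y - torusUnit L i, y] s, i) ∉ S → G y i s = G' y i s) → Φ G = Φ G')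
    (σ : TensorIndex (TorusSite 2 L) q) :
    ∃ X : PEPSBoundary D 2 2, ∀ β : torusBlock L 2 2 x → Fin q,
      (∑ G : TorusSite 2 L → Fin 2 → Fin 2 → Fin D,
        (∏ y, A (Subtype.val.extend β σ y) (G y 0 0) (G y 1 0) (G y 0 1) (G y 1 1)) * Φ G) =
      pepsRect 2 2 A X (fun p => β (torusBlockElem L 2 2 x p)) := by
  set B := torusBlock L 2 2 x with hB
  have hbij : Function.Bijective (torusBlockElem L 2 2 x) := torusBlockElem_bijective L 2 2 hL hL x
  -- glued leg configurations and the reduced virtual tensor on the legs of the block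
  let glue : (B → Fin 2 → Fin 2 → Fin D) → ({y // y ∉ B} → Fin 2 → Fin 2 → Fin D) →
      TorusSite 2 L → Fin 2 → Fin 2 → Fin D :=
    fun GB Gout y => if h : y ∈ B then GB ⟨y, h⟩ else Gout ⟨y, h⟩
  let Y : (B → Fin 2 → Fin 2 → Fin D) → ℂ := fun GB =>
    ∑ Gout : {y // y ∉ B} → Fin 2 → Fin 2 → Fin D,
      (∏ y : {y // y ∉ B}, A (σ y) (Gout y 0 0) (Gout y 1 0) (Gout y 0 1) (Gout y 1 1)) *
        Φ (glue GB Gout)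
  -- block legs in block coordinates
  have hf : Function.Bijective fun (GB : B → Fin 2 → Fin 2 → Fin D) (p : Fin 2 × Fin 2) =>
      GB (torusBlockElem L 2 2 x p) := hbij.comp_right
  set gL := Equiv.ofBijective _ hf with hgL
  have hsymm : ∀ (G' : Fin 2 × Fin 2 → Fin 2 → Fin 2 → Fin D) (p : Fin 2 × Fin 2),
      gL.symm G' (torusBlockElem L 2 2 x p) = G' p := fun G' p => by
    have h := congrFun (gL.apply_symm_apply G') p
    simp only [hgL, Equiv.ofBijective_apply] at h
    exact h
  have hglue_site : ∀ (GB : B → Fin 2 → Fin 2 → Fin D) (Gout : {y // y ∉ B} → Fin 2 → Fin 2 → Fin D)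
      (p : Fin 2 × Fin 2), glue GB Gout (torusBlockSite L 2 2 x p) = GB (torusBlockElem L 2 2 x p) := by
    intro GB Gout p
    have hp : torusBlockSite L 2 2 x p ∈ B := Finset.mem_image_of_mem _ (Finset.mem_univ p)
    simp only [glue, dif_pos hp]
    rfl
  -- matching of the bonds of `S` for a glued configuration = inner matching in block coordinates
  have hmatch : ∀ (G' : Fin 2 × Fin 2 → Fin 2 → Fin 2 → Fin D)
      (Gout : {y // y ∉ B} → Fin 2 → Fin 2 → Fin D),
      (∀ b ∈ S, glue (gL.symm G') Gout b.1 b.2 1 =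
        glue (gL.symm G') Gout (b.1 + torusUnit L b.2) b.2 0) ↔
      ((∀ b : Fin 2, G' (0, b) 0 1 = G' (1, b) 0 0) ∧ (∀ a : Fin 2, G' (a, 0) 1 1 = G' (a, 1) 1 0)) := by
    intro G' Gout
    rw [forall_innerBond_iff x hS]
    simp only [hglue_site, hsymm]
  -- a reference inner-matched block configuration with prescribed outer legs
  let G₀ : (Fin 2 → Fin D) → (Fin 2 → Fin D) → (Fin 2 → Fin D) → (Fin 2 → Fin D) →
      Fin 2 × Fin 2 → Fin 2 → Fin 2 → Fin D :=
    fun l u r d p => ![![l p.2, ![l p.2, r p.2] p.1], ![u p.1, ![u p.1, d p.1] p.2]]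
  have hG₀ : ∀ l u r d : Fin 2 → Fin D,
      (∀ b : Fin 2, G₀ l u r d (0, b) 0 1 = G₀ l u r d (1, b) 0 0) ∧
      (∀ a : Fin 2, G₀ l u r d (a, 0) 1 1 = G₀ l u r d (a, 1) 1 0) := by
    intro l u r d
    exact ⟨fun b => by simp [G₀], fun a => by simp [G₀]⟩
  -- `Y` vanishes off the inner-matched configurations ...
  have hY0 : ∀ G' : Fin 2 × Fin 2 → Fin 2 → Fin 2 → Fin D,
      ¬ ((∀ b : Fin 2, G' (0, b) 0 1 = G' (1, b) 0 0) ∧ (∀ a : Fin 2, G' (a, 0) 1 1 = G' (a, 1) 1 0)) →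
      Y (gL.symm G') = 0 := by
    intro G' hin
    simp only [Y]
    refine Finset.sum_eq_zero fun Gout _ => ?_
    rw [h1 _ ?_, mul_zero]
    by_contra hall
    push Not at hall
    exact hin ((hmatch G' Gout).1 hall)
  -- ... and on them depends only on the outer legs
  have hYinv : ∀ G' : Fin 2 × Fin 2 → Fin 2 → Fin 2 → Fin D,
      ((∀ b : Fin 2, G' (0, b) 0 1 = G' (1, b) 0 0) ∧ (∀ a : Fin 2, G' (a, 0) 1 1 = G' (a, 1) 1 0)) →
      Y (gL.symm G') = Y (gL.symm (G₀ (fun b => G' (0, b) 0 0) (fun a => G' (a, 0) 1 0)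
        (fun b => G' (1, b) 0 1) (fun a => G' (a, 1) 1 1))) := by
    intro G' hin
    simp only [Y]
    refine Finset.sum_congr rfl fun Gout _ => ?_
    congr 1
    refine h2 _ _ ((hmatch G' Gout).2 hin) ((hmatch _ Gout).2 (hG₀ (fun b => G' (0, b) 0 0)
      (fun a => G' (a, 0) 1 0) (fun b => G' (1, b) 0 1) (fun a => G' (a, 1) 1 1))) fun y i s hyis => ?_
    by_cases hy : y ∈ B
    · obtain ⟨⟨a, b⟩, -, rfl⟩ := Finset.mem_image.1 hy
      rw [legBond_torusBlockSite_mem_iff hL x hS] at hyis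
      simp only [ne_eq, not_not] at hyis
      rw [hglue_site, hglue_site, hsymm, hsymm]
      fin_cases i <;> fin_cases s <;> (simp at hyis; subst hyis; simp [G₀])
    · simp only [glue, dif_neg hy]
  refine ⟨fun l u r d => Y (gL.symm (G₀ l u r d)), fun β => ?_⟩
  -- Step 1: split the leg sum along the block
  have hstep1 : (∑ G : TorusSite 2 L → Fin 2 → Fin 2 → Fin D,
      (∏ y, A (Subtype.val.extend β σ y) (G y 0 0) (G y 1 0) (G y 0 1) (G y 1 1)) * Φ G) =
      ∑ GB : B → Fin 2 → Fin 2 → Fin D,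
        (∏ y : B, A (β y) (GB y 0 0) (GB y 1 0) (GB y 0 1) (GB y 1 1)) * Y GB := by
    rw [sum_eq_sum_offBlock_sum_block B, Finset.sum_comm]
    refine Finset.sum_congr rfl fun GB _ => ?_
    simp only [Y, glue, Finset.mul_sum]
    refine Finset.sum_congr rfl fun Gout _ => ?_
    have hb : ∀ y : B, Subtype.val.extend β σ y = β y := fun y =>
      Subtype.val_injective.extend_apply β σ y
    have ho : ∀ y : {y // y ∉ B}, Subtype.val.extend β σ y = σ y := fun y =>
      Function.extend_val_apply' y.2
    simp only [prod_glue_eq B (fun (y : TorusSite 2 L) (g : Fin 2 → Fin 2 → Fin D) =>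
      A (Subtype.val.extend β σ y) (g 0 0) (g 1 0) (g 0 1) (g 1 1)), hb, ho]
    ring
  -- Step 2: block coordinates
  have hstep2 : (∑ GB : B → Fin 2 → Fin 2 → Fin D,
      (∏ y : B, A (β y) (GB y 0 0) (GB y 1 0) (GB y 0 1) (GB y 1 1)) * Y GB) =
      ∑ G' : Fin 2 × Fin 2 → Fin 2 → Fin 2 → Fin D,
        (∏ p, A (β (torusBlockElem L 2 2 x p)) (G' p 0 0) (G' p 1 0) (G' p 0 1) (G' p 1 1)) *
          Y (gL.symm G') := by
    rw [← gL.symm.sum_comp]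
    refine Finset.sum_congr rfl fun G' _ => ?_
    congr 1
    symm
    refine Fintype.prod_bijective _ hbij _ _ fun p => ?_
    rw [hsymm]
  rw [hstep1, hstep2, pepsRect_two_two_eq_sum_legs]
  refine Finset.sum_congr rfl fun G' _ => ?_
  by_cases hin : (∀ b : Fin 2, G' (0, b) 0 1 = G' (1, b) 0 0) ∧
      (∀ a : Fin 2, G' (a, 0) 1 1 = G' (a, 1) 1 0)
  · rw [if_pos hin, hYinv G' hin]
  · rw [if_neg hin, hY0 G' hin, mul_zero]

/-- **`δ_all ∈ V_S` for every set of bonds `S`**: the indicator of the fully matched leg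
configurations vanishes off the `S`-matched ones and is invariant under matched changes of the
legs of `S` (a bond outside `S` has both its legs outside the legs of `S`). [folklore] -/
theorem indicator_allMatched_mem_bondSpace {L : ℕ} [NeZero L] (S : Finset (TorusSite 2 L × Fin 2))
    (c : ℂ) :
    (∀ G : TorusSite 2 L → Fin 2 → Fin 2 → Fin D,
      (∃ b ∈ S, G b.1 b.2 1 ≠ G (b.1 + torusUnit L b.2) b.2 0) →
      (if (∀ (y : TorusSite 2 L) (i : Fin 2), G y i 1 = G (y + torusUnit L i) i 0) then c else 0) = 0) ∧
    (∀ G G' : TorusSite 2 L → Fin 2 → Fin 2 → Fin D,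
      (∀ b ∈ S, G b.1 b.2 1 = G (b.1 + torusUnit L b.2) b.2 0) →
      (∀ b ∈ S, G' b.1 b.2 1 = G' (b.1 + torusUnit L b.2) b.2 0) →
      (∀ y i s, (![y - torusUnit L i, y] s, i) ∉ S → G y i s = G' y i s) →
      (if (∀ (y : TorusSite 2 L) (i : Fin 2), G y i 1 = G (y + torusUnit L i) i 0) then c else 0) =
        if (∀ (y : TorusSite 2 L) (i : Fin 2), G' y i 1 = G' (y + torusUnit L i) i 0) then c else 0) := by
  classical
  refine ⟨fun G ⟨b, _, hb⟩ => if_neg fun h => hb (h b.1 b.2), fun G G' hG hG' hGG' => ?_⟩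
  have key : ∀ (z : TorusSite 2 L) (i : Fin 2),
      (G z i 1 = G (z + torusUnit L i) i 0 ↔ G' z i 1 = G' (z + torusUnit L i) i 0) := by
    intro z i
    by_cases hzi : (z, i) ∈ S
    · exact ⟨fun _ => hG' (z, i) hzi, fun _ => hG (z, i) hzi⟩
    · have h1 : G z i 1 = G' z i 1 := hGG' z i 1 hzi
      have h0 : G (z + torusUnit L i) i 0 = G' (z + torusUnit L i) i 0 :=
        hGG' (z + torusUnit L i) i 0 (by simpa using hzi)
      rw [h1, h0]
  simp only [key]

/-! ### The parent Hamiltonian theorem (Schuch–Cirac–Pérez-García Thm. 5.7 with Thm. 5.9, `G = 1`) -/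

/-- **Growing the region** (the iteration in the proof of Schuch–Cirac–Pérez-García (2010)
Thm. 5.7: "we divide the Hamiltonian in blocks … by virtue of the intersection property"): a
virtual tensor lying in `V_{S_x}` for every anchor `x` of a set `T` lies in `V_{⋃_{x ∈ T} S_x}`, by
induction on `T` with `bondSpace_inter`. [cite: SchuchCiracPerezGarcia2010, Thm. 5.7] -/
theorem bondSpace_biUnion {L : ℕ} (Sx : TorusSite 2 L → Finset (TorusSite 2 L × Fin 2))
    (Φ : (TorusSite 2 L → Fin 2 → Fin 2 → Fin D) → ℂ)
    (h : ∀ x : TorusSite 2 L,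
      (∀ G : TorusSite 2 L → Fin 2 → Fin 2 → Fin D,
        (∃ b ∈ Sx x, G b.1 b.2 1 ≠ G (b.1 + torusUnit L b.2) b.2 0) → Φ G = 0) ∧
      (∀ G G' : TorusSite 2 L → Fin 2 → Fin 2 → Fin D,
        (∀ b ∈ Sx x, G b.1 b.2 1 = G (b.1 + torusUnit L b.2) b.2 0) →
        (∀ b ∈ Sx x, G' b.1 b.2 1 = G' (b.1 + torusUnit L b.2) b.2 0) →
        (∀ y i s, (![y - torusUnit L i, y] s, i) ∉ Sx x → G y i s = G' y i s) → Φ G = Φ G'))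
    (T : Finset (TorusSite 2 L)) :
    (∀ G : TorusSite 2 L → Fin 2 → Fin 2 → Fin D,
      (∃ b ∈ T.biUnion Sx, G b.1 b.2 1 ≠ G (b.1 + torusUnit L b.2) b.2 0) → Φ G = 0) ∧
    (∀ G G' : TorusSite 2 L → Fin 2 → Fin 2 → Fin D,
      (∀ b ∈ T.biUnion Sx, G b.1 b.2 1 = G (b.1 + torusUnit L b.2) b.2 0) →
      (∀ b ∈ T.biUnion Sx, G' b.1 b.2 1 = G' (b.1 + torusUnit L b.2) b.2 0) →
      (∀ y i s, (![y - torusUnit L i, y] s, i) ∉ T.biUnion Sx → G y i s = G' y i s) →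
        Φ G = Φ G') := by
  classical
  induction T using Finset.induction_on with
  | empty =>
    rw [Finset.biUnion_empty]
    exact bondSpace_empty Φ
  | insert a T ha ih =>
    rw [Finset.biUnion_insert]
    exact bondSpace_inter (h a).1 (h a).2 ih.1 ih.2

/-- **Discharge of `pepsParent_groundSpace_of_injective` — the parent Hamiltonian theorem for
injective PEPS** (Schuch–Cirac–Pérez-García (2010) Thm. 5.7 together with Thm. 5.9 for the trivial
group, i.e. Pérez-García–Verstraete–Wolf–Cirac (2008) Thm. 3): for a single-site injective tensor
`A` and `2 ≤ L`, the zero-energy space of `H = Σ_x (1 - Π_{𝒮_{2×2}})_x` on the `L × L` torus is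
`ℂ · ψ_A`. Proof as printed, at the virtual level: let `T` be a left inverse of `𝒫(A)`
(`exists_leg_leftInverse`, Def. 3.1). (⇒) If `H ψ = 0`, every `2 × 2` block slice of `ψ` is a
block state (`exists_boundary_of_pepsParentHamiltonian_mulVec_eq_zero`: null space of a sum of
projectors = intersection), so `Φ = T^{⊗Λ} ψ` lies in `V_{S_x}` for the inner bonds `S_x` of every
block (`virtualT_mem_bondSpace`), hence in `V_{all bonds}` (intersection property, Thm. 5.4:
`bondSpace_inter`, `bondSpace_biUnion`), which is the line `ℂ δ_all` (closure property, Thm. 5.5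
with only the trivial closure: `bondSpace_univ`); and `ψ = 𝒫^{⊗Λ} T^{⊗Λ} ψ`
(`sum_prod_mul_eq_self_of_forall_update`, `sum_pi_update_eq_self_of_slices`) `= c 𝒫^{⊗Λ} δ_all
= c ψ_A` (`pepsTorus_eq_sum_legs`). (⇐) `ψ_A = 𝒫^{⊗Λ} δ_all` has block-state slices along every
block (`exists_pepsRect_slice_virtualP`, `δ_all ∈ V_{S_x}`), so every `h_x` kills it
(frustration-freeness, `localOp_torusBlock_mulVec_eq_zero`). Degenerate `q = 0`: the Hilbert space
is `0`. [cite: SchuchCiracPerezGarcia2010, Thm. 5.7 and Thm. 5.9] -/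
theorem pepsParent_groundSpace_of_injective_holds : pepsParent_groundSpace_of_injective := by
  intro q D A hA L _ hL ψ
  -- degenerate local dimension `q = 0`: there are no configurations
  rcases Nat.eq_zero_or_pos q with rfl | hq
  · haveI : IsEmpty (TensorIndex (TorusSite 2 L) 0) := ⟨fun σ => Fin.elim0 (σ 0)⟩
    exact ⟨fun _ => ⟨0, funext fun σ => isEmptyElim σ⟩, fun _ => funext fun σ => isEmptyElim σ⟩
  -- the inner bonds `S_x` of the block anchored at `x`
  set Sx : TorusSite 2 L → Finset (TorusSite 2 L × Fin 2) := fun x =>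
    (Finset.univ : Finset (Fin 2 × Fin 2)).image fun ic =>
      (torusBlockSite L 2 2 x (![((0 : Fin 2), ic.2), (ic.2, 0)] ic.1), ic.1) with hSx_def
  have hSx : ∀ (x : TorusSite 2 L) (b : TorusSite 2 L × Fin 2), b ∈ Sx x ↔
      ∃ i c : Fin 2, b = (torusBlockSite L 2 2 x (![((0 : Fin 2), c), (c, 0)] i), i) := by
    intro x b
    simp only [hSx_def, Finset.mem_image, Finset.mem_univ, true_and, Prod.exists]
    exact ⟨fun ⟨i, c, h⟩ => ⟨i, c, h.symm⟩, fun ⟨i, c, h⟩ => ⟨i, c, h.symm⟩⟩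
  -- every bond is an inner bond of some block
  have huniv : (Finset.univ : Finset (TorusSite 2 L)).biUnion Sx = Finset.univ := by
    refine Finset.eq_univ_of_forall fun b => ?_
    obtain ⟨z, i⟩ := b
    rw [Finset.mem_biUnion]
    refine ⟨z, Finset.mem_univ _, (hSx z _).2 ⟨i, 0, ?_⟩⟩
    have h0 : torusBlockSite L 2 2 z (0, 0) = z := torusBlockSite_zero_zero L 1 1 z
    have hi : (![((0 : Fin 2), (0 : Fin 2)), (0, 0)] i) = (0, 0) := by fin_cases i <;> rfl
    rw [hi, h0]
  -- the left inverse of `𝒫(A)`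
  obtain ⟨t, ht⟩ := exists_leg_leftInverse A hA
  constructor
  · intro h0
    have hslice := exists_boundary_of_pepsParentHamiltonian_mulVec_eq_zero L hL A ψ h0
    -- `Φ = T^{⊗Λ} ψ` lies in every `V_{S_x}`, hence in `V_{all bonds} = ℂ δ_all`
    have hV := fun x => virtualT_mem_bondSpace L hL hq A t ht x ψ (hslice x) (hSx x)
    have hVall := bondSpace_biUnion Sx _ hV Finset.univ
    rw [huniv] at hVall
    obtain ⟨c, hc⟩ := bondSpace_univ hVall.1 hVall.2
    have hc' : ∀ G : TorusSite 2 L → Fin 2 → Fin 2 → Fin D,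
        (∑ τ : TensorIndex (TorusSite 2 L) q, (∏ y, t (G y) (τ y)) * ψ τ) =
          if (∀ (y : TorusSite 2 L) (i : Fin 2), G y i 1 = G (y + torusUnit L i) i 0) then c else 0 := by
      intro G
      exact congrFun hc G
    refine ⟨c, funext fun σ => ?_⟩
    -- `ψ = 𝒫^{⊗Λ} T^{⊗Λ} ψ = 𝒫^{⊗Λ} (c δ_all) = c ψ_A`
    have hfix := sum_prod_mul_eq_self_of_forall_update
      (fun s s' => ∑ g : Fin 2 → Fin 2 → Fin D, A s (g 0 0) (g 1 0) (g 0 1) (g 1 1) * t g s') ψ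
      (fun y τ => sum_pi_update_eq_self_of_slices L hL A t ht ψ hslice y τ) σ
    rw [← hfix, ← virtual_rightComp_apply A t ψ σ]
    simp only [hc', Pi.smul_apply, smul_eq_mul, pepsTorus_eq_sum_legs, Finset.mul_sum]
    refine Finset.sum_congr rfl fun G _ => ?_
    split_ifs <;> ring
  · rintro ⟨c, rfl⟩
    rw [mulVec_smul]
    suffices h : pepsParentHamiltonian L 2 2 A *ᵥ pepsTorus L A = 0 by rw [h, smul_zero]
    unfold pepsParentHamiltonian
    rw [Matrix.sum_mulVec]
    refine Finset.sum_eq_zero fun x _ => localOp_torusBlock_mulVec_eq_zero L hL A x _ fun σ => ?_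
    -- `ψ_A = 𝒫^{⊗Λ} δ_all` and `δ_all ∈ V_{S_x}`
    have hind := indicator_allMatched_mem_bondSpace (D := D) (Sx x) (1 : ℂ)
    obtain ⟨X, hX⟩ := exists_pepsRect_slice_virtualP L hL A x (hSx x)
      (fun G => if (∀ (y : TorusSite 2 L) (i : Fin 2), G y i 1 = G (y + torusUnit L i) i 0)
        then (1 : ℂ) else 0) hind.1 hind.2 σ
    refine ⟨X, fun β => ?_⟩
    rw [← hX β, pepsTorus_eq_sum_legs]
    refine Finset.sum_congr rfl fun G _ => ?_
    split_ifs <;> simp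

end QLattice

end Literature.MathematicalPhysics.QuantumLattice
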